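import Summits.NavierStokesRegularity.NavierStokesRegularity.Theses.TypeICertificateLadder
import Summits.NavierStokesRegularity.NavierStokesRegularity.Theorems.BlowupBlowupClayNonuniquenessRefutation
import Summits.NavierStokesRegularity.NavierStokesRegularity.Theorems.TypeICertificateLadderTypeIConcentrationBP
import Summits.NavierStokesRegularity.NavierStokesRegularity.Theorems.TypeICertificateLadderTypeIConcentration
import Literature.Analysis.FluidPDE.NSQuasipotential

/-!
# Disproof of `TypeIConcentration` — findings (crux stmt-NavierStokesRegularity-2881, route TypeICertificateLadder)

Standing-adversary workfile (cdisprove, generations 1–5, last update gen 5, 2026-08-16T04Z; `lean check` rc 0,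
0 sorry, axioms {propext, Classical.choice, Quot.sound} on every theorem). Generation 1's file (evidence
`20260815T223011Z-Disproof.lean`, not readable from compute-free hubs) was RECONSTRUCTED by gen 2 and
is extended here; this tree copy (`Cruxes/TypeIConcentration/Disproof.lean`) is the one to read in
scratch checks. LANDED / IMPORTABLE negative lemmas (gen 3, Negative lane):
`Summits/…/Theorems/TypeIConcentration/Negative/LoadBearing.lean` (namespace
`…Theorems.TypeIConcentration.Negative`: `typeIConcentration_false_without_noExtension`,
`typeIConcentration_level_false_without_LerayHopf` (every `C`), `typeIConcentration_false_without_LerayHopf`,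
`scaledEnergyBound_false_without_LerayHopf`, `calmCoresPersist_core_false_without_LerayHopf`,
`mass_le_of_rate`, `no_witness_above_rate_ceiling`, `typeIConcentration_hyps_false_below_rungZero`,
`not_memLp_driftI`; witness = the Type-I drift `drift (gI c)` of
`Theorems/RungReynoldsOne/Negative/WithoutLerayHopfFalse.lean`, the same flow as `odeVel` below).

GEN-5 NEWS — THE CRUX IS SETTLED: PROVED (read first; 2026-08-16T04Z). Item stmt-NavierStokesRegularity-2881
was CLOSED `proved` at 2026-08-16T04:08:38Z by `Theorems.typeIConcentration_proof`
(`Theorems/TypeICertificateLadderTypeIConcentration.lean`, the lead's closing file p77693, line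
`bp-scaled-energy`: `uniformMorrey_of_rate` ← decaying Lemma 3.5 `stub_scaledEnergyVertexEventually`
(p76070, `…TypeIConcentrationDecay.lean`) ∘ `morrey_of_typeI` zoom; then `scaledEnergyBound_proof` = support
2884 VERBATIM; then `bp_concentration_of_morrey` (Barker–Prange 2020 Thm 2, PROVED) with `M := max A 1`).
THIS SEAT RE-VERIFIED IT INDEPENDENTLY: re-elaboration of the route decl BY NAME from the landed module, rc 0,
axiom closure exactly {propext, Classical.choice, Quot.sound} (no `sorryAx`, no vendored-fact hypothesis: the
theorem's type is the Theses decl verbatim, so nothing is assumed). "PROVED FOR THE WRONG REASON?" audit (gen 5):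
the only conceivable hollowness is joint unsatisfiability of the five hypotheses for JUNK reasons. The fields of
`IsLerayHopfOn T ν 0 (u 0) u` that touch the blow-up time itself (`memLp` and the energy inequality on `Icc 0 T`,
weak `L²`-continuity on `Ioc 0 T`) constrain the otherwise-junk slice `u T`; they are met by the INTENDED objects
(a classical solution blowing up at `T` agrees on `[0,T)` with its global Leray weak continuation by weak–strong
uniqueness, and `u T :=` that continuation's slice = the weak-`L²` limit of `u t`, `t ↑ T`, satisfies all three),
exactly the packaging already used inside `bp_concentration_of_morrey`. So the hypotheses are satisfiable PRECISELY
by finite-energy Type-I(`C`) blow-ups from rapidly decaying data — whether any exist is the open rung `X_C` /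
item 1217, not a junk question — and the theorem has its intended content. §8 records the settlement as checked
Lean: `not_not_typeIConcentration` (every refutation of the crux is now kernel-refutable),
`not_typeIConcentration_iff_false`, `not_not_scaledEnergyBound`, and the STRONGER quantifier shape the landed proof
actually delivers, `typeIConcentration_universal_gamma : ∃ γ > 0, ∀ C > 0, ∃ ρ(C) > 0, …` (γ = γ_BP³ universal; only
the radius depends on the level — cf. §(c): `(ρ, γ)` both uniform in `C` remains unclaimed and implausible).
FINAL VERDICT OF THE STANDING ADVERSARY: SETTLED — PROVED; nothing left to disprove on this crux. What the five
generations leave for the route: the load-bearing map (a), the rate ceiling (b), the refuted neighbours (c), the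
forced quantifier shape of the vertex stub (§7), all LANDED under `Theorems/TypeIConcentration/Negative/`.

GEN-4 NEWS (2026-08-16T03Z). (1) The lead RESHAPED the picked line `Lines/bp-scaled-energy.lean`
(skeleton eb9f89d1): its ONE registered stub is now `stub_scaledEnergyVertexEventually (K)` —
Seregin–Šverák 2009 Lemma 3.5 at the vertex for LOCAL suitable weak solutions in `Q(0,1)`, in the
EVENTUAL `K`-only form `∃ d(K) ∀ M' ≠ ⊤ ∃ r₁(K, M') ∀ (v,q,G) … data ≤ M' → ∀ r < r₁, A+E+C+D ≤ d`;
the composition stub → `uniformMorrey_of_rate` → item 2884 verbatim → crux (via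
`bp_concentration_of_morrey`) is sorry-free in the skeleton. (2) VERDICT ON THE STUB: TRUE and
provable from the tree — the symmetry-free AFFINE Lemma 3.5 `Theorems.scaledEnergy_vertex_le_of_typeI`
(`A+E+C+D ≤ a(K)·data + d(K)` on `0 < r < 1/4`, LANDED) is built from the contraction
`decay_step_half` / `iterate_halving` + the window absorption (as11) `cubicC_absorb_vertex`;
iterating the contraction `≍ log M'` more times gives the eventual form (the lead's `work/Decay.lean`;
candidate proofs of 2881 are attached to the item). Definitions honest (no representative or
Bochner junk: `energyA` is an `essSup` in `t`, `C, D, E` are space–time `lintegral`s; the local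
energy inequality is CKN (2.5) in integrated form; integrands are `L¹` in the suitable class).
Junk LOCAL solutions (parasitic / potential flows `v = ∇h`) are harmless GIVEN the data bound:
harmonic slices ⇒ `|v| ≲ √A(0,3/4)` near the vertex ⇒ all scaled functionals `→ 0`. (3) NEW
checked Targets content (§7; LANDED as `Theorems/TypeIConcentration/Negative/VertexStubParasitic.lean`):
the stub's QUANTIFIER SHAPE IS FORCED — with `∃ r₁` before `∀ M'` (data-free range) it is FALSE at
every `K > 0`, and the `K`-only bound on ALL scales `r < 1/4` (affine Lemma 3.5 with `a(K) = 0`) is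
FALSE at every `K > 0`, both by the δ-regularised KNSS parasitic flow `u = (K/√(δ²−t)) e₀`
(suitable weak in `Q(0,1)`, rate ≤ K, finite data, `C(0,r) ≥ 3|B_r|K³/(8r²δ) → ∞`; p77728), and —
independently, already at `K = 0` — by the pressure GAUGE `(v,q) = (0,λ)` (`D` subtracts no mean:
`D(0,r;λ) ≥ |B_r|λ^{3/2}`; `VertexStubGauge.lean`, `vertexStub_false_of_dataFreeRange_gauge`,
LANDED p78013). So the data `M'` enter ONLY through `r₁ ↓ 0`; eventual statements have content only at SINGULAR vertices
(regular ⇒ every functional `→ 0`), which is why "d must grow with K" and "the rate is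
load-bearing for the stub" are NOT Lean-testable (no singular Type-I object is constructible).
(4) Sibling landings since gen 3: `Negative/ScaledEnergyBoundPosT.lean` (drefute seat: `0 < T` is
load-bearing for item 2884, `scaledEnergyBound_false_without_posT`, pre-initial junk slices).

GEN-3 NEWS. (1) `Theorems.bp_concentration_of_morrey` is LANDED (p70174): §2's
`typeIConcentration_of_scaledEnergyBound : ScaledEnergyBound → TypeIConcentration` is now
kernel-checked — on the Barker–Prange line the crux IS item 2884 and nothing else. (2) Two crux-plan
lines bypass 2884 altogether (no Morrey bound, no ε-regularity): PROP M / no-nucleation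
(`Lines/oseen-tail-calm-core-confinement.lean`) and the subcritical upgrade
(`Lines/quiet-point-subcritical-upgrade.lean`, ACTIVE skeleton); §6 records this seat's cheap attacks
on their 11 stubs: NONE KILLED, all re-derived on paper with the stated constants; the two
load-bearing stubs are FALSE WITHOUT LERAY–HOPF (checked theorems: the calm core nucleates).
(3) Vacuity below Leray's floor (`level_vacuous_below_rungZero`, from the proved `RungZero`) and
monotonicity in the level (`rateNear_mono`): the crux has content only for `C > C₀`, and is
equivalent to its restriction to any cofinal set of levels.

THE CRUX (`typeIConcentration_iff`, readback): `∀ C>0 ∃ ρ>0 ∃ γ>0 ∀ ν,T>0 ∀ (u,p)`: classical NS on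
`ℝ³×[0,T)` → Leray–Hopf on `[0,T)` from `u 0` → Schwartz datum → eventual rate
`√(T−t)‖u(t,x)‖ ≤ C√ν` (`RateNear`) → no smooth extension past `T` → `∃ x₀ ∀ᶠ t↑T,
γν³ ≤ ∫_{B(x₀, ρ√(ν(T−t)))} ‖u(t)‖³` (`Concentrates`). Quantifier order as printed (Barker–Prange:
fixed centre = the singular point); coercions/junk: none (Bochner set integral of a continuous
integrand on a ball; `Real.sqrt` only of non-negative arguments in the live regime).

## Verdict: SETTLED — PROVED (gen 5, §8). History (gens 1–4): RESISTS — the crux is a THEOREM OF CLAY (A); refuting it = refuting the summit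
* `typeIConcentration_of_navierStokesRegularity` : `NavierStokesRegularity → TypeIConcentration`,
  sorry-free from tree theorems (`Literature.NS.blowup_assembly` + the proved uniqueness `X5b`,
  `Theorems.BlowupBlowupClayNonuniqueness_refuted`); contrapositive
  `not_navierStokesRegularity_of_not_typeIConcentration`. So the item can be closed `refuted` only by
  a negative solution of the Millennium problem; route kill-criterion (ii) ("TypeIConcentration refuted
  ⇒ restate over boxes (C, A)") can never fire on truth grounds — what CAN fail is only the intended
  PROOF (the C-only dependence through 2884), i.e. provability, not validity.
* `typeIConcentration_of_noTypeIBlowup` : `NoTypeIBlowup → TypeIConcentration` (vacuity, any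
  constants); `typeIConcentration_of_rungs` : `(∀ C, X_C) → TypeIConcentration`. A counterexample to
  the crux at level `C` is a finite-energy Type-I(C) blow-up from Schwartz data, killing item 1217 and
  every rung above its rate constant. No cheaper kill exists: every object satisfying the five
  hypotheses is such a blow-up.
* Positive side (for the provers): the crux = `BarkerPrange2020_thm2` (PROVED in tree) ∘ support
  2884 `ScaledEnergyBound` (Morrey constant `A(C)`, the real content) ∘ glue — and the glue is now
  LANDED: `Theorems.bp_concentration_of_morrey` (p70174), so `typeIConcentration_of_scaledEnergyBound`
  (§2) is kernel-checked; `ρ = ρ_BP(√(max(A(C),1)))`, `γ = γ_univ³`. On this line the only risk is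
  2884 (Gronwall on the local energy inequality from `t′ = T − r²/ν`, checked on paper by gen 1:
  `A(C) ≲ C²e^{κ(1+C)}`; the far-field pressure closes linearly via `∇p_far` and the rate on one
  factor: `|∇p_far| ≲ ‖u‖_∞ r^{-5/2} e^{1/2}`, coefficient `‖u(s)‖_∞/r`, time-integral `2C`).
  Independently, the two 2884-free lines of §6 (PROP M; subcritical upgrade) were re-derived on
  paper without gap: the crux is TRUE ON PAPER TWICE OVER; what remains is formalisation.

## (a) Load-bearing hypotheses — `_false_without_` theorems
* `typeIConcentration_false_without_noExtension` : drop `¬HasSmoothExtensionPast` ⇒ FALSE (rest state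
  `u ≡ 0`: classical, Leray–Hopf, Schwartz, rate for every `C`, zero mass).
* `typeIConcentration_false_without_LerayHopf` : drop `IsLerayHopfOn` ⇒ FALSE at every level `C`
  (ODE blow-up `u = c((1−t)^{-1/2}−1)e₁`, `p = −ȧx₁`, §4: classical for every `ν`
  (`isClassicalNSSolutionOn_odeVel`), Schwartz datum `0`, EXACT Type-I rate `c(1−√(1−t)) ≤ c`
  (`rateNear_odeVel`), no continuation (`not_hasSmoothExtensionPast_odeVel`), similarity-scale mass
  `|B₁|ρ³c³(1−√(1−t))³ ≤ |B₁|ρ³c³ < γ` for small `c` (`mass_odeVel_eq/le`)). The violated clause is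
  pinpointed: `not_memLp_odeVel` (`u(t) ∉ L²`, so `IsLerayHopfOn.memLp` fails; `not_isLerayHopfOn_odeVel`).
  MORAL: `γ(C)` is an ε-regularity threshold bought with the finite-energy structure (local energy
  inequality + Riesz pressure), never a consequence of rate + PDE identity + datum.
* `typeIConcentration_iff_withoutPositivity` : `0<ν`, `0<T` are decoration (`ν ≤ 0`: conclusion
  trivial; `T ≤ 0`: `HasSmoothExtensionPast` automatic, `hasSmoothExtensionPast_of_nonpos`).
* NOT testable in Lean (no object satisfies the remaining hypotheses without an actual blow-up):
  dropping `HasRapidSpatialDecay (u 0)` (reviewers: possibly unnecessary given Leray–Hopf; it is used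
  only for the far-field/singular-point glue) and dropping/weakening `RateNear` (then `C` disappears;
  universal-constant parabolic-scale concentration at EVERY singular point is open in print — see §6
  of the notes below).

## (b) Tightness
* `mass_le_of_rate` : under `RateNear C` alone the witness functional is bounded,
  `∫_{B(x₀,ρ√(ν(T−t)))}‖u‖³ ≤ |B₁|ρ³C³ν³` eventually, at EVERY centre (`|B₁| = unitBallVol = 4π/3`).
* `no_witness_above_rate_ceiling` : a pair `(ρ,γ)` can witness concentration for a rate-`C` field only
  if `γ ≤ |B₁|ρ³C³`; above the ceiling the level-`C` crux is literally the rung `X_C`.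
* The ceiling is asymptotically ATTAINED in the classical (infinite-energy) class by the ODE flow with
  `c = C` (`mass_odeVel_eq`: `|B₁|ρ³C³(1−√(1−t))³ ↑ |B₁|ρ³C³`).

## (c) Natural strengthenings / neighbours
* `scaledEnergyBound_false_without_LerayHopf` (§5): support 2884 without Leray–Hopf is FALSE (same ODE
  flow: `r⁻¹∫_{B_r}|u|² = |B₁|r²a(t)² → ∞` at fixed `r = r₀`); the pointwise rate controls only radii
  `r ≲ √(ν(T−t))`, so 2884's all-scales Morrey constant must come from the energy structure.
* Strengthenings that keep all five hypotheses (`∀ρ ∃γ`, `(ρ,γ)` uniform in `C`, conclusion at every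
  point / with `∀ᶠ t, ∃ x₀` swapped back, `L²`- or `L^∞`-forms of the witness) are exactly as
  irrefutable as the crux (no admissible test object); recorded in prose only: `∀ρ>0 ∃γ` is NOT
  claimed by Barker–Prange (radius `2/√S*(M)` is specific) and should not be assumed by certificate
  designers; `(ρ,γ)` uniform in `C` is implausible (drift heuristics: under Type-I(C) a concentration
  centre may sit at similarity distance `≍ C` from `x₀`, so honest `ρ(C) ≳ C`).

## Literature status of the concentration phenomenon (read in the sources, 2026-08-15)
* FIXED centre at a singular point, radius `O(√(T−t))`: Barker–Prange 2020 Thm 2 (arXiv:1812.09115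
  pp.4–5), under the Morrey-type Type-I bound (e.typeI) with constant `M`; radius `2√((T−t)/S*(M))`,
  threshold `γ_univ` universal. In tree and PROVED (`BarkerPrange2020_thm2_holds`). From the pointwise
  rate only `M(M′,u₀,r)` is in print (ibid. p.5, citing Seregin–Zajączkowski, Seregin 2018 pp.844–849)
  — the uniform `M(C)` is exactly support 2884 (elementary Gronwall on the local energy inequality
  from `t′ = T − r²/ν`, checked on paper: `A(C) ≲ C²e^{κ(1+C)}`; the ODE flow of §4–§5 shows the
  energy structure is indispensable for it).
* MOVING centre, NO Type-I hypothesis, universal constants: Li–Ozawa–Wang 2018 (CPAA 17) along a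
  sequence `tₙ↑T`, Maekawa–Miura–Prange 2017 (arXiv, "Estimates … half-space for non localized data")
  for every `t`: `∃ x(t)` with `‖u(t)‖_{L³(B(x(t), √(C(T−t))))} ≥ C` (quoted from BP p.4, which adds:
  "no information is provided on xₙ and x(t)"). So the WEAK form `∀ᶠ t, ∃ x₀` of the crux's conclusion
  is a universal theorem independent of `C` — but it is useless for `CertificateSoundness`: telescoping
  needs the witness `f_ρ(U_{x₀}(s)) ≥ γ` along ONE Leray trajectory (fixed `x₀`) on long `s`-intervals;
  a wandering centre gives only `O(1)`-length intervals per centre. The fixed centre — hence Type I,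
  hence 2884 — is essential to the METHOD, not merely to this item's wording.
* Same engine, alternative source for provers: Kang–Miura–Tsai (arXiv:1812.10509) Thm 1.1 / Cor 1.2:
  local-`L³`-small data are regular for time `T₁(M)δ²`, `T₁(M) = ε(1+M)^{-6}`,
  `M = (C/δ) sup_{x₀}∫_{B_δ(x₀)}|v₀|²` — needs the Morrey quantity at ONE time only. Read backwards from
  a singular point it gives the crux with `ρ(C) ≈ ε^{-1/2}(1 + cA(C))³`: through this route the
  certified radius grows like `e^{3κC}` and `γ = ε₀³` is an ε-regularity constant — the quantitative
  face of the route's method-kill criterion (iii) (honest radius is heuristically only `ρ(C) ≍ C`: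
  Leray-profile decay `|U(y)| ≲ 1/|y|` beyond `|y| ≍ C`).

## (d) Targets
No stuck stubs filed (payload.stuck_stubs = [] in gens 3–5); the picked line COMPLETED (stub p76070, closing
file p77693, item closed `proved` 2026-08-16T04:08:38Z). Gen 4 (§7): the picked line's single stub
`stub_scaledEnergyVertexEventually` — TRUE (provable from landed affine Lemma 3.5 + contraction);
its quantifier shape is forced (`vertexStub_false_of_dataFreeRange`, `vertexStub_false_allScales`,
Negative lane file `VertexStubParasitic.lean`). Gen 3 (§6): the 11 registered/planned stubs of the
two fallback lines audited (all survive cheap attacks; `calmCoresPersist_false_without_LerayHopf`,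
`quietDecayUpgrade_false_without_LerayHopf` pin finite energy as load-bearing for the two hardest).

## (e) Near-misses
none: every statement attempted here closed; the crux itself is now closed POSITIVELY (§8), and its
all-hypotheses strengthenings of §(c) stay irrefutable for the structural reason in the Verdict.
-/

noncomputable section

set_option linter.dupNamespace false

namespace Summit.NavierStokesRegularity.NavierStokesRegularity.Cruxes.TypeIConcentration.Disproof

open Set Filter Topology MeasureTheory Metric Function
open Literature.Analysis.FluidPDE
open Summit.NavierStokesRegularity.NavierStokesRegularity.Theses.TypeICertificateLadder
open scoped ContDiff Laplacian InnerProductSpace RealInnerProductSpace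

local notation "E3" => EuclideanSpace ℝ (Fin 3)

/-! ## §0 Readback of the crux: named pieces -/

/-- The eventual dimensionless Type-I(C) rate near `T`: `√(T−t) ‖u(t,x)‖ ≤ C √ν` for all `x`
and all `t < T` close to `T` (the fourth hypothesis of the crux, verbatim). -/
def RateNear (C ν T : ℝ) (u : ℝ → E3 → E3) : Prop :=
  ∀ᶠ t in 𝓝[<] T, ∀ x, Real.sqrt (T - t) * ‖u t x‖ ≤ C * Real.sqrt ν

/-- The conclusion of the crux at constants `(ρ, γ)`: a FIXED centre `x₀` around which the local
`L³` mass at the similarity scale stays `≥ γ ν³` for all `t < T` close to `T` (verbatim). -/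
def Concentrates (ρ γ ν T : ℝ) (u : ℝ → E3 → E3) : Prop :=
  ∃ x₀ : E3, ∀ᶠ t in 𝓝[<] T,
    γ * ν ^ 3 ≤ ∫ x in Metric.ball x₀ (ρ * Real.sqrt (ν * (T - t))), ‖u t x‖ ^ 3

/-- Readback (definitional): the crux is `∀ C>0 ∃ ρ>0 ∃ γ>0 ∀ ν T>0 ∀ (u,p)`, classical on
`[0,T)` → Leray–Hopf → Schwartz datum → `RateNear C` → no smooth extension → `Concentrates ρ γ`. -/
theorem typeIConcentration_iff :
    TypeIConcentration ↔
      ∀ C : ℝ, 0 < C → ∃ ρ : ℝ, 0 < ρ ∧ ∃ γ : ℝ, 0 < γ ∧ ∀ (ν T : ℝ), 0 < ν → 0 < T →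
        ∀ (u : ℝ → E3 → E3) (p : ℝ → E3 → ℝ),
          IsClassicalNSSolutionOn (Set.Ico 0 T) ν 0 u p → IsLerayHopfOn T ν 0 (u 0) u →
          HasRapidSpatialDecay (u 0) → RateNear C ν T u → ¬ HasSmoothExtensionPast ν 0 u T →
          Concentrates ρ γ ν T u :=
  Iff.rfl

/-! ## §1 Load-bearing hypotheses -/

/-- The crux with the hypothesis `¬ HasSmoothExtensionPast ν 0 u T` DROPPED. -/
def TypeIConcentrationWithoutNoExtension : Prop :=
  ∀ C : ℝ, 0 < C → ∃ ρ : ℝ, 0 < ρ ∧ ∃ γ : ℝ, 0 < γ ∧ ∀ (ν T : ℝ), 0 < ν → 0 < T →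
    ∀ (u : ℝ → E3 → E3) (p : ℝ → E3 → ℝ),
      IsClassicalNSSolutionOn (Set.Ico 0 T) ν 0 u p → IsLerayHopfOn T ν 0 (u 0) u →
      HasRapidSpatialDecay (u 0) → RateNear C ν T u → Concentrates ρ γ ν T u

/-- The rest state `u ≡ 0` has Schwartz slices. -/
theorem hasRapidSpatialDecay_zero : HasRapidSpatialDecay (0 : E3 → E3) := by
  intro n K
  refine ⟨0, fun x => ?_⟩
  simp

/-- **`¬ HasSmoothExtensionPast` is load-bearing.** Without it the crux is FALSE: the rest state
`u ≡ 0`, `p ≡ 0` is a classical Leray–Hopf solution with Schwartz datum and the Type-I(C) rate for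
every `C`, and its local `L³` mass is `0 < γ ν³`. -/
theorem typeIConcentration_false_without_noExtension : ¬ TypeIConcentrationWithoutNoExtension := by
  intro h
  obtain ⟨ρ, -, γ, hγ, h⟩ := h 1 one_pos
  have hrate : RateNear 1 1 1 (0 : ℝ → E3 → E3) := Eventually.of_forall fun t x => by simp
  obtain ⟨x₀, hx₀⟩ := h 1 1 one_pos one_pos 0 0 (isClassicalNSSolutionOn_zero _ _)
    (isLerayHopfOn_zero (E := E3) 1 1) hasRapidSpatialDecay_zero hrate
  obtain ⟨t, ht⟩ := hx₀.exists
  simp at ht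
  exact absurd ht (not_le.2 hγ)


/-! ### Positivity side conditions are decoration -/

/-- The crux with the side conditions `0 < ν`, `0 < T` DROPPED. -/
def TypeIConcentrationWithoutPositivity : Prop :=
  ∀ C : ℝ, 0 < C → ∃ ρ : ℝ, 0 < ρ ∧ ∃ γ : ℝ, 0 < γ ∧ ∀ (ν T : ℝ),
    ∀ (u : ℝ → E3 → E3) (p : ℝ → E3 → ℝ),
      IsClassicalNSSolutionOn (Set.Ico 0 T) ν 0 u p → IsLerayHopfOn T ν 0 (u 0) u →
      HasRapidSpatialDecay (u 0) → RateNear C ν T u → ¬ HasSmoothExtensionPast ν 0 u T →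
      Concentrates ρ γ ν T u

/-- For `T ≤ 0` every field "extends smoothly past `T`" (the rest state on `[0, 1)` agrees with it
on `[0, T) = ∅`), so the hypothesis `¬ HasSmoothExtensionPast` is unsatisfiable there. -/
theorem hasSmoothExtensionPast_of_nonpos {ν T : ℝ} (hT : T ≤ 0) (u : ℝ → E3 → E3) :
    HasSmoothExtensionPast ν 0 u T :=
  ⟨1, by linarith, 0, 0, isClassicalNSSolutionOn_zero _ _, fun t ht => absurd ht.2 (not_lt.2 (hT.trans ht.1))⟩

/-- For `ν ≤ 0` the conclusion is trivially true (`γ ν³ ≤ 0 ≤ ∫ ‖u‖³`). -/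
theorem concentrates_of_nonpos {ρ γ ν T : ℝ} (hγ : 0 ≤ γ) (hν : ν ≤ 0) (u : ℝ → E3 → E3) :
    Concentrates ρ γ ν T u := by
  refine ⟨0, Eventually.of_forall fun t => ?_⟩
  have h1 : γ * ν ^ 3 ≤ 0 :=
    mul_nonpos_of_nonneg_of_nonpos hγ (Odd.pow_nonpos (by decide) hν)
  exact h1.trans (integral_nonneg fun x => by positivity)

/-- **`0 < ν` and `0 < T` are decoration**: the crux is equivalent to its version without them
(for `ν ≤ 0` the conclusion is trivial, for `T ≤ 0` the no-extension hypothesis fails). Any proof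
may ignore them; any disproof must live at `ν > 0`, `T > 0` (and then, by scaling, at `ν = T = 1`). -/
theorem typeIConcentration_iff_withoutPositivity :
    TypeIConcentration ↔ TypeIConcentrationWithoutPositivity := by
  refine ⟨fun h C hC => ?_, fun h C hC => ?_⟩
  · obtain ⟨ρ, hρ, γ, hγ, h⟩ := h C hC
    refine ⟨ρ, hρ, γ, hγ, fun ν T u p hcl hLH hdec hrate hext => ?_⟩
    by_cases hν : 0 < ν
    · by_cases hT : 0 < T
      · exact h ν T hν hT u p hcl hLH hdec hrate hext
      · exact absurd (hasSmoothExtensionPast_of_nonpos (not_lt.1 hT) u) hext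
    · exact concentrates_of_nonpos hγ.le (not_lt.1 hν) u
  · obtain ⟨ρ, hρ, γ, hγ, h⟩ := h C hC
    exact ⟨ρ, hρ, γ, hγ, fun ν T _ _ u p hcl hLH hdec hrate hext => h ν T u p hcl hLH hdec hrate hext⟩

/-! ## §2 The crux cannot die alone: it is implied by the route's own target -/

/-- The rung statement `X_C` of the ladder (verbatim the antecedent of `LadderGlue`). -/
def Rung (C : ℝ) : Prop :=
  ∀ (ν T : ℝ), 0 < ν → 0 < T → ∀ (u : ℝ → E3 → E3) (p : ℝ → E3 → ℝ),
    IsClassicalNSSolutionOn (Set.Ico 0 T) ν 0 u p → IsLerayHopfOn T ν 0 (u 0) u →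
    HasRapidSpatialDecay (u 0) → RateNear C ν T u → HasSmoothExtensionPast ν 0 u T

/-- The eventual rate gives `IsTypeIBlowup` (with constant `C √ν`). -/
theorem isTypeIBlowup_of_rateNear {C ν T : ℝ} {u : ℝ → E3 → E3} (h : RateNear C ν T u) :
    IsTypeIBlowup u T := by
  refine ⟨C * Real.sqrt ν, ?_⟩
  filter_upwards [h, self_mem_nhdsWithin] with t ht htT x
  have hpos : 0 < Real.sqrt (T - t) := Real.sqrt_pos.2 (sub_pos.2 htT)
  rw [le_div_iff₀ hpos]
  simpa [mul_comm] using ht x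

/-- **Level by level**: the rung `X_C` makes the level-`C` instance of the crux VACUOUSLY true
(its hypotheses then contradict each other), with any constants, e.g. `ρ = γ = 1`. -/
theorem typeIConcentration_of_rungs (hX : ∀ C : ℝ, 0 < C → Rung C) : TypeIConcentration := by
  intro C hC
  refine ⟨1, one_pos, 1, one_pos, fun ν T hν hT u p hcl hLH hdec hrate hext => ?_⟩
  exact absurd (hX C hC ν T hν hT u p hcl hLH hdec hrate) hext

/-- **The crux is implied by the route's target** `NoTypeIBlowup` (item 1217). Contrapositive:
ANY refutation of `TypeIConcentration` exhibits a Type-I blow-up from Schwartz data and thereby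
refutes `NoTypeIBlowup` (and every rung `X_C` above the blow-up's rate constant) — the crux can
only be killed together with the whole positive route. -/
theorem typeIConcentration_of_noTypeIBlowup (h : NoTypeIBlowup) : TypeIConcentration :=
  typeIConcentration_of_rungs fun _ _ ν T hν hT u p hcl hLH hdec hrate =>
    h ν T hν hT u p hcl hLH hdec (isTypeIBlowup_of_rateNear hrate)

/-- Contrapositive packaging of `typeIConcentration_of_noTypeIBlowup`. -/
theorem not_noTypeIBlowup_of_not_typeIConcentration (h : ¬ TypeIConcentration) : ¬ NoTypeIBlowup :=
  fun hI => h (typeIConcentration_of_noTypeIBlowup hI)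

/-- **The crux is a consequence of the SUMMIT**: Clay (A) ⇒ `TypeIConcentration`, sorry-free from
tree theorems. A counterexample to the crux is a maximal smooth Leray–Hopf solution from a Schwartz
datum (`X5a` of route Blowup); Fefferman class (A) is a uniqueness class against such solutions
(`X5b`, PROVED in tree: `Theorems.BlowupBlowupClayNonuniqueness_refuted` = `¬¬X5b`, from Tao 2013
Cor. 11.4), and `X5a ∧ X5b → ¬(A)` is the tree's `Literature.NS.blowup_assembly`. HENCE: refuting this
crux means solving the Millennium problem in the negative; as long as (A) is open the crux is
consistent, and no refuter can close it `refuted` without that. -/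
theorem typeIConcentration_of_navierStokesRegularity (hA : _root_.NavierStokesRegularity) :
    TypeIConcentration := by
  by_contra h
  refine Literature.NS.blowup_assembly ⟨?_, not_not.1
    Summit.NavierStokesRegularity.NavierStokesRegularity.Theorems.BlowupBlowupClayNonuniqueness_refuted⟩ hA
  by_contra hX5a
  apply h
  intro C _
  refine ⟨1, one_pos, 1, one_pos, fun ν T hν hT u p hcl hLH hdec _ hext => ?_⟩
  exact absurd ⟨ν, hν, T, hT, u, p, ⟨hcl, hext⟩, hLH, hdec⟩ hX5a

/-- Contrapositive: **a disproof of `TypeIConcentration` disproves Clay (A).** -/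
theorem not_navierStokesRegularity_of_not_typeIConcentration (h : ¬ TypeIConcentration) :
    ¬ _root_.NavierStokesRegularity :=
  fun hA => h (typeIConcentration_of_navierStokesRegularity hA)

/-- **The crux REDUCES to the support item 2884 (`ScaledEnergyBound`)**, kernel-checked with the
LANDED packaging `Theorems.bp_concentration_of_morrey` (p70174, 2026-08-15: Barker–Prange 2020 Thm 2
∘ Leray's weak continuation ∘ weak–strong uniqueness ∘ singular point): `ScaledEnergyBound →
TypeIConcentration` with `ρ(C) = ρ_BP(√(max(A(C),1)))`, `γ = γ_univ³` (the Morrey form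
`∫_{B_r} ≤ M²ν²r` is 2884's `r⁻¹∫_{B_r} ≤ Aν²` with `M² = max(A,1)`). So on the Barker–Prange line
the ONLY open content of the crux is the uniform Morrey constant `A(C)` of 2884 (generation 3). -/
theorem typeIConcentration_of_scaledEnergyBound (h : ScaledEnergyBound) : TypeIConcentration := by
  obtain ⟨γ, hγ, hBP⟩ :=
    Summit.NavierStokesRegularity.NavierStokesRegularity.Theorems.bp_concentration_of_morrey
  intro C hC
  obtain ⟨A, hA⟩ := h C hC
  set M : ℝ := Real.sqrt (max A 1) with hM
  have hM0 : 0 < M := Real.sqrt_pos.2 (lt_of_lt_of_le one_pos (le_max_right _ _))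
  have hM2 : A ≤ M ^ 2 := by
    rw [hM, Real.sq_sqrt (le_trans zero_le_one (le_max_right _ _))]
    exact le_max_left _ _
  obtain ⟨ρ, hρ, hBPM⟩ := hBP M hM0
  refine ⟨ρ, hρ, γ, hγ, fun ν T hν hT u p hcl hLH hdec hrate hext => ?_⟩
  obtain ⟨r₀, hr₀, hmor⟩ := hA ν T hν hT u p hcl hLH hdec hrate
  refine hBPM ν T hν hT u p hcl hLH hdec ⟨r₀, hr₀, ?_⟩ hext
  filter_upwards [hmor] with t ht y r hr hrr
  have h1 := ht y r hr hrr
  have hr' : 0 ≤ r := hr.le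
  have hν2 : 0 ≤ ν ^ 2 := by positivity
  have h3 := mul_le_mul_of_nonneg_right h1 hr'
  rw [mul_comm r⁻¹, inv_mul_cancel_right₀ hr.ne'] at h3
  calc ∫ x in Metric.ball y r, ‖u t x‖ ^ 2 ≤ A * ν ^ 2 * r := h3
    _ ≤ M ^ 2 * ν ^ 2 * r := by gcongr

/-- Contrapositive: **a disproof of the crux disproves 2884** (and, by
`not_navierStokesRegularity_of_not_typeIConcentration`, Clay (A)). -/
theorem not_scaledEnergyBound_of_not_typeIConcentration (h : ¬ TypeIConcentration) :
    ¬ ScaledEnergyBound :=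
  fun hS => h (typeIConcentration_of_scaledEnergyBound hS)

/-- **Monotonicity in the level**: a rate-`C'` field is a rate-`C` field for `C' ≤ C`, so
constants good at level `C` serve every lower level, and the crux is equivalent to its restriction
to any cofinal set of levels (`C ∈ ℕ`, `C ≥ C₀`, …). -/
theorem rateNear_mono {C C' ν T : ℝ} (h : C' ≤ C) {u : ℝ → E3 → E3} (hr : RateNear C' ν T u) :
    RateNear C ν T u := by
  filter_upwards [hr] with t ht x
  exact (ht x).trans (mul_le_mul_of_nonneg_right h (Real.sqrt_nonneg _))

/-- **The level-`C` statement is ANTITONE in `C` for fixed constants**: if `(ρ, γ)` witness the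
crux at level `C`, they witness it at every level `C' ≤ C`. Hence `C ↦ (best ρ(C), best γ(C))` may be
taken monotone, and a proof for an unbounded sequence of levels `C_n ↑ ∞` proves the crux. -/
theorem level_antitone {C C' ρ γ : ℝ} (hCC : C' ≤ C)
    (h : ∀ (ν T : ℝ), 0 < ν → 0 < T → ∀ (u : ℝ → E3 → E3) (p : ℝ → E3 → ℝ),
      IsClassicalNSSolutionOn (Set.Ico 0 T) ν 0 u p → IsLerayHopfOn T ν 0 (u 0) u →
      HasRapidSpatialDecay (u 0) → RateNear C ν T u → ¬ HasSmoothExtensionPast ν 0 u T →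
      Concentrates ρ γ ν T u) :
    ∀ (ν T : ℝ), 0 < ν → 0 < T → ∀ (u : ℝ → E3 → E3) (p : ℝ → E3 → ℝ),
      IsClassicalNSSolutionOn (Set.Ico 0 T) ν 0 u p → IsLerayHopfOn T ν 0 (u 0) u →
      HasRapidSpatialDecay (u 0) → RateNear C' ν T u → ¬ HasSmoothExtensionPast ν 0 u T →
      Concentrates ρ γ ν T u :=
  fun ν T hν hT u p hcl hLH hdec hrate hext =>
    h ν T hν hT u p hcl hLH hdec (rateNear_mono hCC hrate) hext

/-- So the crux is equivalent to its restriction to INTEGER levels `C = n + 1`, `n : ℕ` (any cofinal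
family of levels would do). -/
theorem typeIConcentration_iff_nat_levels :
    TypeIConcentration ↔
      ∀ n : ℕ, ∃ ρ : ℝ, 0 < ρ ∧ ∃ γ : ℝ, 0 < γ ∧ ∀ (ν T : ℝ), 0 < ν → 0 < T →
        ∀ (u : ℝ → E3 → E3) (p : ℝ → E3 → ℝ),
          IsClassicalNSSolutionOn (Set.Ico 0 T) ν 0 u p → IsLerayHopfOn T ν 0 (u 0) u →
          HasRapidSpatialDecay (u 0) → RateNear ((n : ℝ) + 1) ν T u →
          ¬ HasSmoothExtensionPast ν 0 u T → Concentrates ρ γ ν T u := by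
  refine ⟨fun h n => h ((n : ℝ) + 1) (by positivity), fun h C hC => ?_⟩
  obtain ⟨n, hn⟩ := exists_nat_gt C
  obtain ⟨ρ, hρ, γ, hγ, hlev⟩ := h n
  exact ⟨ρ, hρ, γ, hγ, level_antitone (by linarith) hlev⟩

/-- **Vacuity below Leray's floor** (generation 3): with `C₀ > 0` the constant of the PROVED support
item `RungZero` (Leray 1934 §19 (3.9); `RungZero_holds`), for every level `C ≤ C₀` the five
hypotheses of the crux are contradictory — a rate-`C` solution extends past `T`. -/
theorem level_vacuous_below_rungZero :
    ∃ C₀ : ℝ, 0 < C₀ ∧ ∀ C : ℝ, C ≤ C₀ → ∀ (ν T : ℝ), 0 < ν → 0 < T →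
      ∀ (u : ℝ → E3 → E3) (p : ℝ → E3 → ℝ),
        IsClassicalNSSolutionOn (Set.Ico 0 T) ν 0 u p → IsLerayHopfOn T ν 0 (u 0) u →
        HasRapidSpatialDecay (u 0) → RateNear C ν T u → ¬ HasSmoothExtensionPast ν 0 u T →
        False := by
  obtain ⟨C₀, hC₀, hX⟩ := RungZero_holds
  refine ⟨C₀, hC₀, fun C hC ν T hν hT u p hcl hLH hdec hrate hext =>
    hext (hX ν T hν hT u p hcl hLH hdec ?_)⟩
  filter_upwards [hrate] with t ht x
  exact (ht x).trans (mul_le_mul_of_nonneg_right hC (Real.sqrt_nonneg _))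

/-- Hence **the crux restricted to levels `C ≤ C₀` holds with ANY constants** (here `ρ = γ = 1`):
its content begins strictly above Leray's constant; the first informative level is the first
rung not excluded by `RungZero` (cf. crux `RungReynoldsOne`, `C = 1`). -/
theorem level_holds_below_rungZero :
    ∃ C₀ : ℝ, 0 < C₀ ∧ ∀ C : ℝ, C ≤ C₀ → ∀ (ν T : ℝ), 0 < ν → 0 < T →
      ∀ (u : ℝ → E3 → E3) (p : ℝ → E3 → ℝ),
        IsClassicalNSSolutionOn (Set.Ico 0 T) ν 0 u p → IsLerayHopfOn T ν 0 (u 0) u →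
        HasRapidSpatialDecay (u 0) → RateNear C ν T u → ¬ HasSmoothExtensionPast ν 0 u T →
        Concentrates 1 1 ν T u := by
  obtain ⟨C₀, hC₀, h⟩ := level_vacuous_below_rungZero
  exact ⟨C₀, hC₀, fun C hC ν T hν hT u p hcl hLH hdec hrate hext =>
    (h C hC ν T hν hT u p hcl hLH hdec hrate hext).elim⟩

/-! ## §3 Tightness: the rate ceiling on the local `L³` mass -/

/-- Volume of a ball of `ℝ³` in terms of the unit ball. -/
theorem volume_ball_eq (x₀ : E3) {r : ℝ} (hr : 0 ≤ r) :
    volume (Metric.ball x₀ r) = ENNReal.ofReal (r ^ 3) * volume (Metric.ball (0 : E3) 1) := by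
  rw [Measure.addHaar_ball volume x₀ hr, finrank_euclideanSpace_fin]

/-- The unit-ball volume of `ℝ³` as a real number (`= 4π/3`; only `0 < · < ∞` is used). -/
def unitBallVol : ℝ := (volume (Metric.ball (0 : E3) 1)).toReal

theorem unitBallVol_pos : 0 < unitBallVol :=
  ENNReal.toReal_pos (measure_ball_pos volume (0 : E3) one_pos).ne' measure_ball_lt_top.ne

theorem volume_real_ball_eq (x₀ : E3) {r : ℝ} (hr : 0 ≤ r) :
    volume.real (Metric.ball x₀ r) = r ^ 3 * unitBallVol := by
  rw [measureReal_def, volume_ball_eq x₀ hr, ENNReal.toReal_mul, ENNReal.toReal_ofReal (by positivity),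
    unitBallVol]

/-- **Rate ceiling.** Under the Type-I(C) rate alone, the local `L³` mass at the similarity scale
is eventually `≤ |B₁| ρ³ C³ ν³` around EVERY centre: the crux's witness functional
`f_ρ(U) = ∫_{|y|<ρ} |U|³` is bounded by `|B₁| ρ³ C³` on the Type-I(C) class (this is also the
bound `M` needed for it in `CertificateSoundness`). -/
theorem mass_le_of_rate {C ν T : ℝ} (hν : 0 ≤ ν) {u : ℝ → E3 → E3} (hrate : RateNear C ν T u)
    {ρ : ℝ} (hρ : 0 ≤ ρ) (x₀ : E3) :
    ∀ᶠ t in 𝓝[<] T, ∫ x in Metric.ball x₀ (ρ * Real.sqrt (ν * (T - t))), ‖u t x‖ ^ 3 ≤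
      unitBallVol * ρ ^ 3 * C ^ 3 * ν ^ 3 := by
  filter_upwards [hrate, self_mem_nhdsWithin] with t ht htT
  have hpos : 0 < Real.sqrt (T - t) := Real.sqrt_pos.2 (sub_pos.2 htT)
  have hC : 0 ≤ C * Real.sqrt ν := le_trans (by positivity) (ht x₀)
  set r := ρ * Real.sqrt (ν * (T - t)) with hr
  have hr0 : 0 ≤ r := by positivity
  have hbound : ∀ x ∈ Metric.ball x₀ r, ‖‖u t x‖ ^ 3‖ ≤ (C * Real.sqrt ν / Real.sqrt (T - t)) ^ 3 := by
    intro x _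
    rw [Real.norm_of_nonneg (by positivity)]
    have hx : ‖u t x‖ ≤ C * Real.sqrt ν / Real.sqrt (T - t) := by
      rw [le_div_iff₀ hpos]; simpa [mul_comm] using ht x
    exact pow_le_pow_left₀ (norm_nonneg _) hx 3
  have h1 := norm_setIntegral_le_of_norm_le_const
    (measure_ball_lt_top : volume (Metric.ball x₀ r) < ⊤) hbound
  rw [volume_real_ball_eq x₀ hr0] at h1
  refine (Real.le_norm_self _).trans (h1.trans (le_of_eq ?_))
  have hs : Real.sqrt (ν * (T - t)) = Real.sqrt ν * Real.sqrt (T - t) := Real.sqrt_mul hν _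
  rw [hr, hs, div_pow, mul_pow, mul_pow, mul_pow]
  have hνs : Real.sqrt ν ^ 3 * Real.sqrt ν ^ 3 = ν ^ 3 := by
    rw [← mul_pow, Real.mul_self_sqrt hν]
  field_simp
  rw [← hνs]; ring

/-- **No admissible witness above the ceiling**: if some field with the Type-I(C) rate (`ν > 0`)
concentrates with constants `(ρ, γ)`, then `γ ≤ |B₁| ρ³ C³`. So in the crux only pairs with
`γ ≤ |B₁| ρ³ C³` can ever be USED; larger `γ` make the level-`C` statement equivalent to the rung
`X_C` itself (vacuity). -/
theorem no_witness_above_rate_ceiling {C ν T ρ γ : ℝ} (hν : 0 < ν) (hρ : 0 ≤ ρ) {u : ℝ → E3 → E3}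
    (hrate : RateNear C ν T u) (hconc : Concentrates ρ γ ν T u) : γ ≤ unitBallVol * ρ ^ 3 * C ^ 3 := by
  obtain ⟨x₀, hx₀⟩ := hconc
  obtain ⟨t, ht1, ht2⟩ := (hx₀.and (mass_le_of_rate hν.le hrate hρ x₀)).exists
  have h := ht1.trans ht2
  have hν3 : 0 < ν ^ 3 := by positivity
  nlinarith


/-- **Monotonicity of the admissible constants** (for fields with continuous slices, e.g. the
classical solutions of the crux): concentration with `(ρ, γ)` gives concentration with any
`ρ' ≥ ρ`, `γ' ≤ γ`. So a proof may enlarge the radius and shrink the threshold at will; failure of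
the crux is never "ρ too large". (For non-integrable junk fields the Bochner integral would break
this monotonicity — irrelevant here, the crux's `u t` is smooth.) -/
theorem Concentrates.mono {ρ ρ' γ γ' ν T : ℝ} {u : ℝ → E3 → E3} (h : Concentrates ρ γ ν T u)
    (hu : ∀ᶠ t in 𝓝[<] T, Continuous (u t)) (hρ : ρ ≤ ρ') (hγ : γ' ≤ γ) (hν : 0 ≤ ν) :
    Concentrates ρ' γ' ν T u := by
  obtain ⟨x₀, hx₀⟩ := h
  refine ⟨x₀, ?_⟩
  filter_upwards [hx₀, hu, self_mem_nhdsWithin] with t ht hcont htT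
  have h1 : γ' * ν ^ 3 ≤ γ * ν ^ 3 := mul_le_mul_of_nonneg_right hγ (by positivity)
  refine h1.trans (ht.trans ?_)
  have hTt : 0 ≤ T - t := (sub_pos.2 htT).le
  have hint : IntegrableOn (fun x => ‖u t x‖ ^ 3)
      (Metric.closedBall x₀ (ρ' * Real.sqrt (ν * (T - t)))) volume :=
    ((hcont.norm.pow 3).continuousOn).integrableOn_compact (isCompact_closedBall _ _)
  exact setIntegral_mono_set (hint.mono_set Metric.ball_subset_closedBall)
    (ae_of_all _ fun x => by positivity)
    (Metric.ball_subset_ball (by gcongr)).eventuallyLE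

/-! ## §4 The Leray–Hopf (finite-energy) hypothesis is load-bearing: an ODE blow-up

The spatially constant, pressure-driven flow `u(t,x) = a_c(t) e₁`, `p(t,x) = −ȧ_c(t) x₁` with
`a_c(t) = c ((1−t)^{-1/2} − 1)` solves Navier–Stokes classically on `ℝ³ × [0,1)` for EVERY
viscosity (all spatial derivatives vanish; `∂ₜu = −∇p`), starts from the Schwartz datum `0`, obeys
the Type-I rate `√(1−t) |u| = c (1 − √(1−t)) ≤ c` EXACTLY at the self-similar order, cannot be
continued (`|u(t,0)| → ∞`), and its local `L³` mass at the similarity scale is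
`|B₁| ρ³ c³ (1 − √(1−t))³ ≤ |B₁| ρ³ c³` around every centre — below any prescribed `γ` once `c`
is small. It violates exactly one clause of the crux: `u(t) ∉ L²(ℝ³)` for `t > 0` (infinite
energy; the pressure grows linearly). -/

/-- The amplitude `a_c(t) = c ((1 − t)^{-1/2} − 1)` (`a_c(0) = 0`, `a_c ↑ ∞` as `t ↑ 1`). -/
def odeAmp (c t : ℝ) : ℝ := c * ((Real.sqrt (1 - t))⁻¹ - 1)

/-- The unit vector `e₁`. -/
def e₁ : E3 := EuclideanSpace.single 0 1

theorem norm_e₁ : ‖e₁‖ = 1 := by simp [e₁]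

/-- The ODE velocity `u(t, x) = a_c(t) e₁` (constant in space). -/
def odeVel (c t : ℝ) : E3 → E3 := fun _ => odeAmp c t • e₁

theorem odeVel_def (c t : ℝ) : odeVel c t = fun _ => odeAmp c t • e₁ := rfl

/-- The ODE pressure `p(t, x) = −ȧ_c(t) ⟪e₁, x⟫` (linear in space). -/
def odePres (c : ℝ) : ℝ → E3 → ℝ := fun t x => -(deriv (odeAmp c) t) * inner ℝ e₁ x

theorem odeAmp_zero (c : ℝ) : odeAmp c 0 = 0 := by simp [odeAmp]

theorem odeVel_zero (c : ℝ) : odeVel c 0 = 0 := by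
  funext x; simp [odeVel, odeAmp_zero]

theorem odeAmp_nonneg {c t : ℝ} (hc : 0 ≤ c) (ht : t ∈ Ico (0:ℝ) 1) : 0 ≤ odeAmp c t := by
  have h1 : 0 < 1 - t := sub_pos.2 ht.2
  have h2 : Real.sqrt (1 - t) ≤ 1 := (Real.sqrt_le_sqrt (by linarith [ht.1])).trans_eq Real.sqrt_one
  have h3 : 0 < Real.sqrt (1 - t) := Real.sqrt_pos.2 h1
  have h4 : 1 ≤ (Real.sqrt (1 - t))⁻¹ := one_le_inv_iff₀.2 ⟨h3, h2⟩
  unfold odeAmp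
  exact mul_nonneg hc (by linarith)

/-- The exact dimensionless rate of the ODE flow: `√(1−t) a_c(t) = c (1 − √(1−t))`. -/
theorem sqrt_mul_odeAmp {c t : ℝ} (ht : t < 1) :
    Real.sqrt (1 - t) * odeAmp c t = c * (1 - Real.sqrt (1 - t)) := by
  have h3 : Real.sqrt (1 - t) ≠ 0 := (Real.sqrt_pos.2 (sub_pos.2 ht)).ne'
  have h : Real.sqrt (1 - t) * odeAmp c t =
      c * (Real.sqrt (1 - t) * (Real.sqrt (1 - t))⁻¹) - c * Real.sqrt (1 - t) := by
    unfold odeAmp; ring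
  rw [h, mul_inv_cancel₀ h3]
  ring

theorem contDiffAt_odeAmp (c : ℝ) {t : ℝ} (ht : t < 1) : ContDiffAt ℝ ∞ (odeAmp c) t := by
  have h0 : (1 : ℝ) - t ≠ 0 := (sub_pos.2 ht).ne'
  have h1 : ContDiffAt ℝ ∞ (fun s : ℝ => Real.sqrt (1 - s)) t :=
    (Real.contDiffAt_sqrt h0).comp t (contDiffAt_const.sub contDiffAt_id)
  have h2 : ContDiffAt ℝ ∞ (fun s : ℝ => (Real.sqrt (1 - s))⁻¹) t :=
    h1.inv (Real.sqrt_pos.2 (sub_pos.2 ht)).ne'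
  exact contDiffAt_const.mul (h2.sub contDiffAt_const)

theorem contDiffOn_odeAmp (c : ℝ) : ContDiffOn ℝ ∞ (odeAmp c) (Iio 1) :=
  fun _ ht => (contDiffAt_odeAmp c ht).contDiffWithinAt

theorem contDiffAt_deriv_odeAmp (c : ℝ) {t : ℝ} (ht : t < 1) :
    ContDiffAt ℝ ∞ (deriv (odeAmp c)) t :=
  (((contDiffOn_infty_iff_deriv_of_isOpen isOpen_Iio).1 (contDiffOn_odeAmp c)).2).contDiffAt
    (Iio_mem_nhds ht)

theorem hasDerivAt_odeAmp (c : ℝ) {t : ℝ} (ht : t < 1) :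
    HasDerivAt (odeAmp c) (deriv (odeAmp c) t) t :=
  ((contDiffAt_odeAmp c ht).differentiableAt (by simp)).hasDerivAt

/-- `∇ (k ⟪v, ·⟫) = k v`. -/
theorem hasGradientAt_const_mul_inner (k : ℝ) (v x : E3) :
    HasGradientAt (fun y : E3 => k * inner ℝ v y) (k • v) x := by
  rw [hasGradientAt_iff_hasFDerivAt]
  refine ((InnerProductSpace.toDual ℝ E3 (k • v)).hasFDerivAt).congr_of_eventuallyEq
    (Eventually.of_forall fun y => ?_)
  simp [InnerProductSpace.toDual_apply_apply]

/-- The Laplacian of a constant field vanishes. -/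
theorem laplacian_const (v : E3) (x : E3) : (Δ (fun _ : E3 => v)) x = 0 := by
  rw [InnerProductSpace.laplacian_eq_iteratedFDeriv_stdOrthonormalBasis]
  simp [iteratedFDeriv_const_of_ne]

/-- **The ODE flow is a classical solution** of the unforced Navier–Stokes system on
`ℝ³ × [0, 1)`, for every viscosity `ν` (every spatial derivative of `u` vanishes, and
`∂ₜ u = ȧ e₁ = −∇p`). -/
theorem isClassicalNSSolutionOn_odeVel (c ν : ℝ) :
    IsClassicalNSSolutionOn (Ico 0 1) ν 0 (odeVel c) (odePres c) where
  smooth_velocity := by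
    intro q hq
    have ht : q.1 < 1 := (mem_prod.1 hq).1.2
    have h : ContDiffAt ℝ ∞ (fun q : ℝ × E3 => odeAmp c q.1 • e₁) q :=
      ((contDiffAt_odeAmp c ht).comp q contDiffAt_fst).smul contDiffAt_const
    exact h.contDiffWithinAt
  smooth_pressure := by
    intro q hq
    have ht : q.1 < 1 := (mem_prod.1 hq).1.2
    have h : ContDiffAt ℝ ∞ (fun q : ℝ × E3 => -(deriv (odeAmp c) q.1) * inner ℝ e₁ q.2) q :=
      ((contDiffAt_deriv_odeAmp c ht).comp q contDiffAt_fst).neg.mul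
        (contDiffAt_const.inner ℝ contDiffAt_snd)
    exact h.contDiffWithinAt
  momentum t ht x := by
    have htime : timeDerivWithin (Ico 0 1) (odeVel c) t x = deriv (odeAmp c) t • e₁ := by
      rw [timeDerivWithin_apply]
      exact (((hasDerivAt_odeAmp c ht.2).smul_const e₁).hasDerivWithinAt).derivWithin
        (uniqueDiffOn_Ico 0 1 t ht)
    have hconv : convect (odeVel c t) (odeVel c t) x = 0 := by
      simp [convect, odeVel_def]
    have hlap : (Δ (odeVel c t)) x = 0 := laplacian_const _ x
    have hgrad : gradient (odePres c t) x = (-(deriv (odeAmp c) t)) • e₁ :=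
      (hasGradientAt_const_mul_inner _ e₁ x).gradient
    rw [htime, hconv, hlap, hgrad]
    simp
  divFree t _ x := by
    simp [VectorCalculus.divergence, odeVel_def]

/-- The datum of the ODE flow is the Schwartz field `0`. -/
theorem hasRapidSpatialDecay_odeVel (c : ℝ) : HasRapidSpatialDecay (odeVel c 0) := by
  rw [odeVel_zero]; exact hasRapidSpatialDecay_zero

/-- The ODE flow has the Type-I(C) rate for every `C ≥ c`: `√(1−t) ‖u(t,x)‖ = c (1 − √(1−t)) ≤ c`. -/
theorem rateNear_odeVel {c C : ℝ} (hc : 0 ≤ c) (hcC : c ≤ C) : RateNear C 1 1 (odeVel c) := by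
  filter_upwards [Ioo_mem_nhdsLT one_pos] with t ht x
  have hnn := odeAmp_nonneg hc ⟨ht.1.le, ht.2⟩
  have hs : 0 ≤ Real.sqrt (1 - t) := Real.sqrt_nonneg _
  simp only [odeVel, norm_smul, norm_e₁, mul_one, Real.norm_of_nonneg hnn, Real.sqrt_one]
  rw [sqrt_mul_odeAmp ht.2]
  nlinarith

/-- The amplitude blows up: `a_c(t) → +∞` as `t ↑ 1` (`c > 0`). -/
theorem tendsto_odeAmp {c : ℝ} (hc : 0 < c) : Tendsto (odeAmp c) (𝓝[<] 1) atTop := by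
  have h1 : Tendsto (fun t : ℝ => 1 - t) (𝓝[<] (1 : ℝ)) (𝓝[>] 0) := by
    refine tendsto_nhdsWithin_iff.2 ⟨?_, ?_⟩
    · have h : Tendsto (fun t : ℝ => 1 - t) (𝓝 (1 : ℝ)) (𝓝 (1 - 1)) :=
        tendsto_const_nhds.sub tendsto_id
      rw [sub_self] at h
      exact h.mono_left nhdsWithin_le_nhds
    · filter_upwards [self_mem_nhdsWithin] with t ht
      exact mem_Ioi.2 (sub_pos.2 ht)
  have h2 : Tendsto Real.sqrt (𝓝[>] (0 : ℝ)) (𝓝[>] 0) := by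
    refine tendsto_nhdsWithin_iff.2 ⟨?_, ?_⟩
    · have h := Real.continuous_sqrt.tendsto (0 : ℝ)
      rw [Real.sqrt_zero] at h
      exact h.mono_left nhdsWithin_le_nhds
    · filter_upwards [self_mem_nhdsWithin] with x hx
      exact mem_Ioi.2 (Real.sqrt_pos.2 hx)
  have h3 : Tendsto (fun t : ℝ => (Real.sqrt (1 - t))⁻¹) (𝓝[<] (1 : ℝ)) atTop :=
    tendsto_inv_nhdsGT_zero.comp (h2.comp h1)
  have h4 := (tendsto_atTop_add_const_right _ (-1) h3).const_mul_atTop hc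
  refine h4.congr' (Eventually.of_forall fun t => ?_)
  simp [odeAmp, sub_eq_add_neg]

/-- **The ODE flow cannot be continued**: a classical extension to `[0, T')`, `T' > 1`, would be
continuous at `(1, 0)`, but `‖u(t, 0)‖ = a_c(t) → ∞` as `t ↑ 1`. -/
theorem not_hasSmoothExtensionPast_odeVel {c : ℝ} (hc : 0 < c) (ν : ℝ) :
    ¬ HasSmoothExtensionPast ν 0 (odeVel c) 1 := by
  rintro ⟨T', hT', u', p', hcl, hagree⟩
  have hcont : ContinuousWithinAt (uncurry u') (Ico 0 T' ×ˢ univ) (1, 0) :=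
    hcl.smooth_velocity.continuousOn (1, 0) ⟨⟨zero_le_one, hT'⟩, mem_univ _⟩
  have hpath : Tendsto (fun t : ℝ => ((t, (0 : E3)) : ℝ × E3)) (𝓝[<] 1)
      (𝓝[Ico 0 T' ×ˢ univ] (1, 0)) := by
    refine tendsto_nhdsWithin_iff.2 ⟨?_, ?_⟩
    · exact ((continuous_id.prodMk continuous_const).tendsto 1).mono_left nhdsWithin_le_nhds
    · filter_upwards [Ioo_mem_nhdsLT one_pos] with t ht
      exact ⟨⟨ht.1.le, ht.2.trans hT'⟩, mem_univ _⟩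
  have hlim : Tendsto (fun t => ‖u' t 0‖) (𝓝[<] 1) (𝓝 ‖u' 1 0‖) :=
    (continuous_norm.tendsto _).comp (hcont.tendsto.comp hpath)
  have hinf : Tendsto (fun t => ‖u' t 0‖) (𝓝[<] 1) atTop := by
    refine (tendsto_odeAmp hc).congr' ?_
    filter_upwards [Ioo_mem_nhdsLT one_pos] with t ht
    rw [hagree t ⟨ht.1.le, ht.2⟩]
    simp [odeVel, norm_smul, norm_e₁, Real.norm_of_nonneg (odeAmp_nonneg hc.le ⟨ht.1.le, ht.2⟩)]
  exact not_tendsto_atTop_of_tendsto_nhds hlim hinf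

/-- The local `L³` mass of the ODE flow at the similarity scale, in closed form. -/
theorem mass_odeVel_eq {c ρ : ℝ} (hc : 0 ≤ c) (hρ : 0 ≤ ρ) {t : ℝ} (ht : t ∈ Ico (0:ℝ) 1) (x₀ : E3) :
    ∫ x in Metric.ball x₀ (ρ * Real.sqrt (1 * (1 - t))), ‖odeVel c t x‖ ^ 3 =
      unitBallVol * ρ ^ 3 * c ^ 3 * (1 - Real.sqrt (1 - t)) ^ 3 := by
  have hnn := odeAmp_nonneg hc ht
  have hs0 : 0 ≤ Real.sqrt (1 - t) := Real.sqrt_nonneg _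
  simp only [odeVel, norm_smul, norm_e₁, mul_one, Real.norm_of_nonneg hnn, one_mul]
  rw [setIntegral_const, volume_real_ball_eq x₀ (by positivity), smul_eq_mul]
  rw [show (ρ * Real.sqrt (1 - t)) ^ 3 * unitBallVol * odeAmp c t ^ 3 =
      unitBallVol * ρ ^ 3 * (Real.sqrt (1 - t) * odeAmp c t) ^ 3 by ring, sqrt_mul_odeAmp ht.2]
  ring

/-- Hence the mass is `≤ |B₁| ρ³ c³` at every `t ∈ [0,1)` and every centre. -/
theorem mass_odeVel_le {c ρ : ℝ} (hc : 0 ≤ c) (hρ : 0 ≤ ρ) {t : ℝ} (ht : t ∈ Ico (0:ℝ) 1) (x₀ : E3) :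
    ∫ x in Metric.ball x₀ (ρ * Real.sqrt (1 * (1 - t))), ‖odeVel c t x‖ ^ 3 ≤
      unitBallVol * ρ ^ 3 * c ^ 3 := by
  rw [mass_odeVel_eq hc hρ ht x₀]
  have hs0 : 0 ≤ Real.sqrt (1 - t) := Real.sqrt_nonneg _
  have hs1 : Real.sqrt (1 - t) ≤ 1 := Real.sqrt_le_one.mpr (by linarith [ht.1])
  have h1 : (1 - Real.sqrt (1 - t)) ^ 3 ≤ 1 := pow_le_one₀ (by linarith) (by linarith)
  have h2 : 0 ≤ unitBallVol * ρ ^ 3 * c ^ 3 := by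
    have := unitBallVol_pos; positivity
  nlinarith

/-- The crux with the Leray–Hopf hypothesis `IsLerayHopfOn T ν 0 (u 0) u` DROPPED. -/
def TypeIConcentrationWithoutLerayHopf : Prop :=
  ∀ C : ℝ, 0 < C → ∃ ρ : ℝ, 0 < ρ ∧ ∃ γ : ℝ, 0 < γ ∧ ∀ (ν T : ℝ), 0 < ν → 0 < T →
    ∀ (u : ℝ → E3 → E3) (p : ℝ → E3 → ℝ),
      IsClassicalNSSolutionOn (Set.Ico 0 T) ν 0 u p →
      HasRapidSpatialDecay (u 0) → RateNear C ν T u → ¬ HasSmoothExtensionPast ν 0 u T →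
      Concentrates ρ γ ν T u

/-- **The Leray–Hopf (finite-energy) hypothesis is load-bearing.** Without it the crux is FALSE
at EVERY level `C` (refuted here at `C = 1`; the same witness with `c ≤ C` works at any level):
given `(ρ, γ)`, the ODE flow with `c = min 1 (γ / (2 (|B₁|ρ³ + 1)))` satisfies every remaining
hypothesis and has similarity-scale `L³` mass `≤ |B₁| ρ³ c³ < γ` around every centre at every time.
MORAL for provers: `γ(C)` cannot come from the rate and the PDE alone; it must be an
ε-regularity / concentration threshold that uses the finite-energy (local energy inequality,
Riesz-transform pressure) structure — exactly Barker–Prange's `γ_univ`. -/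
theorem typeIConcentration_false_without_LerayHopf : ¬ TypeIConcentrationWithoutLerayHopf := by
  intro h
  obtain ⟨ρ, hρ, γ, hγ, h⟩ := h 1 one_pos
  set K : ℝ := unitBallVol * ρ ^ 3 with hK
  have hK0 : 0 ≤ K := by have := unitBallVol_pos; positivity
  set c : ℝ := min 1 (γ / (2 * (K + 1))) with hc
  have hc0 : 0 < c := lt_min one_pos (by positivity)
  have hc1 : c ≤ 1 := min_le_left _ _
  have hcγ : K * c ^ 3 < γ := by
    have h3 : c ^ 3 ≤ c := by
      have : c ^ 3 = c * (c * c) := by ring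
      rw [this]
      exact mul_le_of_le_one_right hc0.le (by nlinarith)
    have h4 : c ≤ γ / (2 * (K + 1)) := min_le_right _ _
    have h5 : K * c ≤ K * (γ / (2 * (K + 1))) := mul_le_mul_of_nonneg_left h4 hK0
    have h6 : K * (γ / (2 * (K + 1))) < γ := by
      rw [mul_div_assoc', div_lt_iff₀ (by positivity)]
      nlinarith
    nlinarith [mul_le_mul_of_nonneg_left h3 hK0]
  obtain ⟨x₀, hx₀⟩ := h 1 1 one_pos one_pos (odeVel c) (odePres c)
    (isClassicalNSSolutionOn_odeVel c 1) (hasRapidSpatialDecay_odeVel c) (rateNear_odeVel hc0.le hc1)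
    (not_hasSmoothExtensionPast_odeVel hc0 1)
  obtain ⟨t, ht1, ht2⟩ := (hx₀.and (Ioo_mem_nhdsLT one_pos)).exists
  have hle := mass_odeVel_le hc0.le hρ.le ⟨ht2.1.le, ht2.2⟩ x₀
  rw [one_pow, mul_one] at ht1
  have : K * c ^ 3 = unitBallVol * ρ ^ 3 * c ^ 3 := by rw [hK]
  linarith


/-! ### The violated clause, pinpointed -/

theorem odeAmp_pos {c t : ℝ} (hc : 0 < c) (ht : t ∈ Ioo (0:ℝ) 1) : 0 < odeAmp c t := by
  have h1 : 0 < 1 - t := by linarith [ht.2]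
  have h2 : Real.sqrt (1 - t) < 1 := by
    rw [Real.sqrt_lt' one_pos]; linarith [ht.1]
  have h3 : 0 < Real.sqrt (1 - t) := Real.sqrt_pos.2 h1
  have h4 : 1 < (Real.sqrt (1 - t))⁻¹ := (one_lt_inv_iff₀).2 ⟨h3, h2⟩
  unfold odeAmp
  exact mul_pos hc (by linarith)

theorem e₁_ne_zero : e₁ ≠ 0 := by
  intro h
  have h1 := norm_e₁
  rw [h, norm_zero] at h1
  exact zero_ne_one h1

/-- **The one clause of the crux the ODE flow violates**: for `0 < t < 1` its velocity slice is a
non-zero constant, hence NOT in `L²(ℝ³)` — the field `IsLerayHopfOn.memLp` (finite kinetic energy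
at every time) fails, and with it the energy inequality / weak formulation. Everything the
provers extract from the rate, smoothness, the datum and the PDE identity alone is therefore
consistent with NO concentration; `γ(C) > 0` must be paid for with the finite-energy structure. -/
theorem not_memLp_odeVel {c : ℝ} (hc : 0 < c) {t : ℝ} (ht : t ∈ Ioo (0:ℝ) 1) :
    ¬ MemLp (odeVel c t) 2 (volume : Measure E3) := by
  have hne : odeAmp c t • e₁ ≠ 0 := smul_ne_zero (odeAmp_pos hc ht).ne' e₁_ne_zero
  rw [odeVel_def, memLp_const_iff two_ne_zero ENNReal.ofNat_ne_top]
  rintro (h | h)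
  · exact hne h
  · simp [measure_univ_of_isAddLeftInvariant] at h

/-- Consequently the ODE flow is not Leray–Hopf on `[0, 1)` (for any viscosity). -/
theorem not_isLerayHopfOn_odeVel {c : ℝ} (hc : 0 < c) (ν : ℝ) :
    ¬ IsLerayHopfOn 1 ν 0 (odeVel c 0) (odeVel c) := fun h =>
  not_memLp_odeVel hc (t := 1 / 2) ⟨by norm_num, by norm_num⟩ (h.memLp (1 / 2) ⟨by norm_num, by norm_num⟩)

/-! ## §5 The same witness against support item 2884 `ScaledEnergyBound` without Leray–Hopf

The pointwise rate controls the scaled local energy `r⁻¹ ∫_{B_r} |u|²` only for radii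
`r ≲ √(ν(T−t))`; at a FIXED radius the ODE flow has `r⁻¹∫_{B_r}|u(t)|² = |B₁| r² a_c(t)² → ∞`.
So the uniform Morrey constant `A(C)` of item 2884 — the constant that makes `ρ(C)` of the crux
independent of the solution via Barker–Prange — must also come from the Leray–Hopf structure
(local energy inequality started at `t' = T − r²/ν`, as in the item's sketch), not from the rate. -/

/-- Support item stmt-NavierStokesRegularity-2884 with the Leray–Hopf hypothesis DROPPED. -/
def ScaledEnergyBoundWithoutLerayHopf : Prop :=
  ∀ C : ℝ, 0 < C → ∃ A : ℝ, ∀ (ν T : ℝ), 0 < ν → 0 < T →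
    ∀ (u : ℝ → E3 → E3) (p : ℝ → E3 → ℝ),
      IsClassicalNSSolutionOn (Set.Ico 0 T) ν 0 u p → HasRapidSpatialDecay (u 0) → RateNear C ν T u →
      ∃ r₀ : ℝ, 0 < r₀ ∧ ∀ᶠ t in 𝓝[<] T, ∀ x₀ : E3, ∀ r : ℝ, 0 < r → r ≤ r₀ →
        r⁻¹ * (∫ x in Metric.ball x₀ r, ‖u t x‖ ^ 2) ≤ A * ν ^ 2

/-- Scaled local energy of the ODE flow in closed form: `r⁻¹ ∫_{B_r(x₀)} |u(t)|² = |B₁| r² a_c(t)²`. -/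
theorem scaledEnergy_odeVel_eq {c : ℝ} (hc : 0 ≤ c) {t : ℝ} (ht : t ∈ Ico (0:ℝ) 1) (x₀ : E3)
    {r : ℝ} (hr : 0 < r) :
    r⁻¹ * (∫ x in Metric.ball x₀ r, ‖odeVel c t x‖ ^ 2) = unitBallVol * r ^ 2 * odeAmp c t ^ 2 := by
  simp only [odeVel, norm_smul, norm_e₁, mul_one, Real.norm_of_nonneg (odeAmp_nonneg hc ht)]
  rw [setIntegral_const, volume_real_ball_eq x₀ hr.le, smul_eq_mul]
  calc r⁻¹ * (r ^ 3 * unitBallVol * odeAmp c t ^ 2)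
        = (r⁻¹ * r) * r ^ 2 * unitBallVol * odeAmp c t ^ 2 := by ring
    _ = unitBallVol * r ^ 2 * odeAmp c t ^ 2 := by rw [inv_mul_cancel₀ hr.ne']; ring

/-- **2884 is false without Leray–Hopf** (ODE flow with `c = C = 1`, radius `r = r₀`, centre `0`). -/
theorem scaledEnergyBound_false_without_LerayHopf : ¬ ScaledEnergyBoundWithoutLerayHopf := by
  intro h
  obtain ⟨A, h⟩ := h 1 one_pos
  obtain ⟨r₀, hr₀, hev⟩ := h 1 1 one_pos one_pos (odeVel 1) (odePres 1)
    (isClassicalNSSolutionOn_odeVel 1 1) (hasRapidSpatialDecay_odeVel 1) (rateNear_odeVel zero_le_one le_rfl)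
  have hsq : Tendsto (fun t => unitBallVol * r₀ ^ 2 * odeAmp 1 t ^ 2) (𝓝[<] 1) atTop := by
    have h2 : Tendsto (fun t => odeAmp 1 t ^ 2) (𝓝[<] 1) atTop :=
      (tendsto_pow_atTop two_ne_zero).comp (tendsto_odeAmp one_pos)
    exact h2.const_mul_atTop (by have := unitBallVol_pos; positivity)
  obtain ⟨t, ⟨hle, hgt⟩, ht⟩ :=
    ((hev.and (hsq.eventually_gt_atTop (A * 1 ^ 2))).and (Ioo_mem_nhdsLT one_pos)).exists
  have h1 := hle 0 r₀ hr₀ le_rfl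
  rw [scaledEnergy_odeVel_eq zero_le_one ⟨ht.1.le, ht.2⟩ 0 hr₀] at h1
  exact absurd h1 (not_le.2 hgt)

/-! ## §6 Targets: the registered stubs of the crux lines (generation 3, 2026-08-16)

PICKED LINE (lead, `PICKED.md` 2026-08-16T01:53Z): `Lines/bp-scaled-energy.lean` — ONE registered stub,
`stub_scaledEnergyBound` = support item 2884 `ScaledEnergyBound` VERBATIM, composed with the landed
`bp_concentration_of_morrey` (the same composition as §2's `typeIConcentration_of_scaledEnergyBound`). This
seat's results for that target: finite energy is load-bearing (`scaledEnergyBound_false_without_LerayHopf`,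
§5; landed in `Theorems/TypeIConcentration/Negative/LoadBearing.lean`); the Gronwall proof re-derived on
paper without gap (`A(C) = (32π/3)C²e^{C₁+2C₂C}`; far pressure via `∇p_far` and the rate on one factor);
`0 < ν` decoration, `0 < T` NOT decoration for 2884 (pre-initial junk slices) — the latter two are the
parallel drefute seat's `Cruxes/TypeIConcentration/DrefuteStubChecks.lean` (which imports this file: the
declarations here are now API — never renamed or removed, only added to). The stub cannot be killed short
of a Type-I blow-up whose Morrey constant at scales `≤ r₀` is not bounded by `A(C)` — i.e. short of
refuting 2884 on a genuine singular solution; no such object is constructible.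

Two further crux-plan skeletons exist (fallbacks, in the lead's order of preference): `Lines/quiet-point-subcritical-upgrade.lean` (the ACTIVE skeleton
f5e8e14ab09b: S1 `stub_oseenRepresentation`, S2 `stub_oseenKernelTail`, S3 `stub_quietDecayUpgrade`
(load-bearing), S4 `stub_quietImpliesRegular`, S5 `stub_loudPointMass`) and
`Lines/oseen-tail-calm-core-confinement.lean` (`stub_oseenMajorantTail`, `stub_shieldIntegral`,
`stub_calmCoresPersist` = PROP M (load-bearing), `stub_gradientUnderEnvelope`, `stub_loudSetBounded`,
`stub_loudPointMass`). CHEAP-ATTACK VERDICTS of this seat — NO STUB IS KILLED. Every stub quantified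
over Clay-class solutions admits no test object but genuine Navier–Stokes solutions (the only
constructible one, `u ≡ 0`, passes each: it is never loud, always quiet, and its cylinders are
bounded), and every pure-analysis stub was re-derived on paper with the constants AS STATED:
* `stub_oseenKernelTail` / `stub_oseenMajorantTail`: TRUE — `‖K(τ,z)[a,b]‖ ≤ C(τ+‖z‖²)^{-2}‖a‖‖b‖`
  (`exists_norm_oseenKernel_le`, `d = 3`) and `∫_{‖z‖≥D} ‖z‖⁻⁴ dz = 4π/D`; the `lintegral` form is
  insensitive to non-measurable `a, b` (bounded by a measurable majorant).
* `stub_shieldIntegral`: TRUE — integrand `≤ m w⁻¹ (w−1)^{-1/2} ∈ L¹(1,∞)` uniformly in `λ ≥ 1` and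
  `→ 0` pointwise as `λ → ∞` (dominated convergence); quantitatively `O(log λ/λ)` (kit j005575 /
  j006964 / j007028 of the ideator and triagers, not re-run here).
* `stub_loudSetBounded`: TRUE — Lipschitz + `L²` ⇒ `v → 0` at infinity (infinitely many disjoint balls
  `B(yₙ, a/(2L))` of mass `≥ (a/2)²|B|` are impossible); `L ≤ 0` makes it vacuous or `v` constant `= 0`.
* `stub_loudPointMass` (both lines): TRUE with the exact constant — the mean value inequality on the
  ball of radius `(c/(2C₁))√(ν(T−t))` gives `‖v‖ ≥ (c/2)√ν/√(T−t)` there, and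
  `|B₁| (c/(2C₁))³ (ν(T−t))^{3/2} · (c/2)³ ν^{3/2} (T−t)^{-3/2} = |B₁| c⁶ ν³/(64 C₁³)` on the nose.
* `stub_gradientUnderEnvelope`: TRUE for mild (= Clay-class) solutions by KNSS (4.6) on the window
  `[t − θ(T−t), t] ⊆ [t₁, T)` (available since `t > (t₁+T)/2`): `(T−t)‖∇u(t)‖ ≲ C·max(1,C)`. (The ODE
  flow has `∇u ≡ 0`, so finite energy is not TESTED by it here.)
* `stub_oseenRepresentation`: TRUE (tree: `ae_eq_heatExtension_sub_oseenDuhamel_of_isMildNSSolutionOn`,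
  `oseenMild_restart_holds`; a.e. → everywhere by continuity of both sides); FALSE without
  Leray–Hopf (ODE flow: `e^{θΔ}` fixes constants and `B(const, const) = 0`, kernel odd in `z`).
* `stub_calmCoresPersist` (PROP M) and `stub_quietDecayUpgrade` (S3): re-derived term by term at
  `ν = 1`, `T − t₁ = 1`: DATA `≤ 1.5c` (quiet part + Gaussian leak over the margin), INSIDE
  `16πC₀c² ≤ c/2` (`∫₁^∞ dw/(w√(w−1)) = π`), OUTSIDE `≤ C²Φ(λ)` after `w = (T−σ)/(T−s*)`: the far-field
  log-divergence `∫ C² dσ/(T−σ)` IS tamed by the receding control region (integrand `O(w^{-3/2})`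
  as `w → ∞` from the tail bound `K/(λ√w)`, `O((w−1)^{-1/2})` as `w → 1` from the min with the
  slice bound). First touching needs only continuity of `F` (classical `u`, continuously shrinking
  compact region) and `F(t₁) ≤ c < 4c` (`ρ ≥ 1 + λ`). No gap found. BOTH ARE FALSE WITHOUT
  LERAY–HOPF (`calmCoresPersist_false_without_LerayHopf`, `quietDecayUpgrade_false_without_LerayHopf`
  below): the calm core `u(t₁) ≡ 0` NUCLEATES the Type-I profile `c(1−√(1−s))/√(1−s)`, driven by the
  linear pressure — in the lines this is excluded exactly at S1 (mild representation).
* `stub_quietImpliesRegular`: TRUE given S3 (data: `L^∞` contraction; inside: subcritical source is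
  time-integrable; outside: kernel sup bound `C D⁻⁴` × energy `2E₀`). Signature note:
  `parabolicCylinder r (T, x₀)` reaches times `< 0` (where `u` is unconstrained junk) when `r² > T`;
  harmless under `∃ r` (take `r ≤ √T`), but a prover must remember to cap `r`.
-/

/-- `√(1 − 15/16) = 1/4`. -/
theorem sqrt_one_sub_fifteen_sixteenths : Real.sqrt (1 - 15 / 16) = 1 / 4 := by
  rw [show (1 : ℝ) - 15 / 16 = (1 / 4) ^ 2 by norm_num, Real.sqrt_sq (by norm_num)]

/-- The ODE flow obeys the Type-I(`C`) ENVELOPE at every `t ∈ [0,1)` (not only eventually), `c ≤ C`. -/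
theorem envelope_odeVel {c C : ℝ} (hc : 0 ≤ c) (hcC : c ≤ C) {t : ℝ} (ht : t ∈ Ico (0:ℝ) 1) (x : E3) :
    Real.sqrt (1 - t) * ‖odeVel c t x‖ ≤ C * Real.sqrt 1 := by
  have hnn := odeAmp_nonneg hc ht
  have hs : 0 ≤ Real.sqrt (1 - t) := Real.sqrt_nonneg _
  simp only [odeVel, norm_smul, norm_e₁, mul_one, Real.norm_of_nonneg hnn, Real.sqrt_one]
  rw [sqrt_mul_odeAmp ht.2]
  nlinarith

/-- PROP M (`stub_calmCoresPersist` of line `oseen-tail-calm-core-confinement`) with its two analytic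
hypotheses (kernel tail, shield functional — closed true statements) and the clause
`IsLerayHopfOn T ν 0 (u 0) u` REMOVED. -/
def CalmCoresPersistCoreWithoutLerayHopf : Prop :=
  ∃ c₀ : ℝ, 0 < c₀ ∧ ∀ C : ℝ, 0 < C → ∀ c : ℝ, 0 < c → c ≤ c₀ → ∃ ρ : ℝ, 1 ≤ ρ ∧
    ∀ (ν T t₁ : ℝ), 0 < ν → 0 < T → 0 ≤ t₁ → t₁ < T →
    ∀ (u : ℝ → E3 → E3) (p : ℝ → E3 → ℝ),
      IsClassicalNSSolutionOn (Set.Ico 0 T) ν 0 u p → HasRapidSpatialDecay (u 0) →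
      (∀ s ∈ Set.Ico t₁ T, ∀ x, Real.sqrt (T - s) * ‖u s x‖ ≤ C * Real.sqrt ν) →
      ∀ x₀ : E3,
        (∀ y ∈ Metric.closedBall x₀ (ρ * Real.sqrt (ν * (T - t₁))),
            Real.sqrt (T - t₁) * ‖u t₁ y‖ ≤ c * Real.sqrt ν) →
        ∀ s ∈ Set.Ico t₁ T, ∀ y ∈ Metric.closedBall x₀ (Real.sqrt (ν * (T - t₁))),
          Real.sqrt (T - s) * ‖u s y‖ ≤ 4 * c * Real.sqrt ν

/-- **PROP M is false without Leray–Hopf: the calm core nucleates.** The ODE flow with `c = C = 1`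
(`ν = T = 1`, `t₁ = 0`, `x₀ = 0`) is classical from the Schwartz datum `0`, hence `c`-quiet at
`t₁ = 0` on EVERY ball for EVERY `c > 0`, obeys the envelope `√(1−s)‖u(s)‖ = 1 − √(1−s) ≤ 1` on
`[0,1) × ℝ³`, yet `√(1−s)‖u(s,0)‖ = 3/4 > 1/2 ≥ 4c` at `s = 15/16` for `c = min(c₀, 1/8)`. (Landed
form over the sibling drift witness: `Theorems/TypeIConcentration/Negative/LoadBearing.lean`.) -/
theorem calmCoresPersist_false_without_LerayHopf : ¬ CalmCoresPersistCoreWithoutLerayHopf := by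
  rintro ⟨c₀, hc₀, h⟩
  set c : ℝ := min c₀ (1 / 8) with hc
  have hc0 : 0 < c := lt_min hc₀ (by norm_num)
  have hcc₀ : c ≤ c₀ := min_le_left _ _
  have hc8 : c ≤ 1 / 8 := min_le_right _ _
  obtain ⟨ρ, -, h⟩ := h 1 one_pos c hc0 hcc₀
  have henv : ∀ s ∈ Set.Ico (0 : ℝ) 1, ∀ x : E3,
      Real.sqrt (1 - s) * ‖odeVel 1 s x‖ ≤ 1 * Real.sqrt 1 :=
    fun s hs x => envelope_odeVel zero_le_one le_rfl hs x
  have hquiet : ∀ y ∈ Metric.closedBall (0 : E3) (ρ * Real.sqrt (1 * (1 - 0))),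
      Real.sqrt (1 - 0) * ‖odeVel 1 0 y‖ ≤ c * Real.sqrt 1 := by
    intro y _
    rw [odeVel_zero]
    simp [hc0.le]
  have h15 : (15 / 16 : ℝ) ∈ Set.Ico (0 : ℝ) 1 := ⟨by norm_num, by norm_num⟩
  have hy : (0 : E3) ∈ Metric.closedBall (0 : E3) (Real.sqrt (1 * (1 - 0))) :=
    Metric.mem_closedBall_self (Real.sqrt_nonneg _)
  have hmain := h 1 1 0 one_pos one_pos le_rfl one_pos (odeVel 1) (odePres 1)
    (isClassicalNSSolutionOn_odeVel 1 1) (hasRapidSpatialDecay_odeVel 1) henv 0 hquiet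
    (15 / 16) h15 0 hy
  have hnn := odeAmp_nonneg zero_le_one h15
  simp only [odeVel, norm_smul, norm_e₁, mul_one, Real.norm_of_nonneg hnn, Real.sqrt_one] at hmain
  rw [sqrt_mul_odeAmp h15.2, sqrt_one_sub_fifteen_sixteenths] at hmain
  linarith

/-- S3 (`stub_quietDecayUpgrade` of line `quiet-point-subcritical-upgrade`) with its two hypotheses
S1, S2 (closed statements) and the clause `IsLerayHopfOn T ν 0 (u 0) u` REMOVED. -/
def QuietDecayUpgradeCoreWithoutLerayHopf : Prop :=
  ∀ C : ℝ, 0 < C → ∃ c : ℝ, 0 < c ∧ ∃ ρ : ℝ, 1 < ρ ∧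
    ∀ (ν T t : ℝ), 0 < ν → 0 ≤ t → t < T →
    ∀ (u : ℝ → E3 → E3) (p : ℝ → E3 → ℝ),
      IsClassicalNSSolutionOn (Set.Ico 0 T) ν 0 u p → HasRapidSpatialDecay (u 0) →
      (∀ s ∈ Set.Ico t T, ∀ x : E3, Real.sqrt (T - s) * ‖u s x‖ ≤ C * Real.sqrt ν) →
      ∀ x₀ : E3,
        (∀ y ∈ Metric.closedBall x₀ (ρ * Real.sqrt (ν * (T - t))),
            Real.sqrt (T - t) * ‖u t y‖ ≤ c * Real.sqrt ν) →
        ∀ s ∈ Set.Ico t T, ∀ y ∈ Metric.closedBall x₀ (Real.sqrt (ν * (T - t))),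
          ‖u s y‖ ≤ 4 * c * Real.sqrt ν * (T - t) ^ (-(3 / 8 : ℝ)) * (T - s) ^ (-(1 / 8 : ℝ))

/-- **S3 is false without Leray–Hopf** (same nucleation, against the subcritical `(T−s)^{-1/8}`
ceiling): for the ODE flow (`c_ode = C = 1`, quiet datum `0`) at `s = 1 − δ⁸`,
`‖u(s,0)‖ = δ⁻⁴ − 1` while the claimed bound is `4c δ⁻¹`; with `δ = min(1/2, 1/(8c+1))` one has
`δ⁻⁴(1 − 4cδ³) ≥ 16 · 7/8 > 1`. So the subcritical upgrade, too, is bought with the mild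
representation (finite energy), not with the envelope and quietness alone. -/
theorem quietDecayUpgrade_false_without_LerayHopf : ¬ QuietDecayUpgradeCoreWithoutLerayHopf := by
  intro h
  obtain ⟨c, hc, ρ, -, h⟩ := h 1 one_pos
  set δ : ℝ := min (1 / 2) (1 / (8 * c + 1)) with hδ
  have hδ0 : 0 < δ := lt_min (by norm_num) (by positivity)
  have hδne : δ ≠ 0 := hδ0.ne'
  have hδ2 : δ ≤ 1 / 2 := min_le_left _ _
  have hδc : δ ≤ 1 / (8 * c + 1) := min_le_right _ _
  have hδ1 : δ < 1 := by linarith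
  have hδ8 : 0 < δ ^ 8 := by positivity
  have hδ8' : δ ^ 8 ≤ 1 := pow_le_one₀ hδ0.le hδ1.le
  set s : ℝ := 1 - δ ^ 8 with hs
  have hsI : s ∈ Set.Ico (0 : ℝ) 1 := ⟨by rw [hs]; linarith, by rw [hs]; linarith⟩
  have h1s : 1 - s = δ ^ 8 := by rw [hs]; ring
  have henv : ∀ s ∈ Set.Ico (0 : ℝ) 1, ∀ x : E3,
      Real.sqrt (1 - s) * ‖odeVel 1 s x‖ ≤ 1 * Real.sqrt 1 :=
    fun s hs x => envelope_odeVel zero_le_one le_rfl hs x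
  have hquiet : ∀ y ∈ Metric.closedBall (0 : E3) (ρ * Real.sqrt (1 * (1 - 0))),
      Real.sqrt (1 - 0) * ‖odeVel 1 0 y‖ ≤ c * Real.sqrt 1 := by
    intro y _
    rw [odeVel_zero]
    simp [hc.le]
  have hy : (0 : E3) ∈ Metric.closedBall (0 : E3) (Real.sqrt (1 * (1 - 0))) :=
    Metric.mem_closedBall_self (Real.sqrt_nonneg _)
  have hmain := h 1 1 0 one_pos le_rfl one_pos (odeVel 1) (odePres 1)
    (isClassicalNSSolutionOn_odeVel 1 1) (hasRapidSpatialDecay_odeVel 1) henv 0 hquiet s hsI 0 hy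
  have hnn := odeAmp_nonneg zero_le_one hsI
  have hsq : Real.sqrt (δ ^ 8) = δ ^ 4 := by
    rw [show δ ^ 8 = (δ ^ 4) ^ 2 by ring, Real.sqrt_sq (by positivity)]
  have hlhs : ‖odeVel 1 s (0 : E3)‖ = (δ ^ 4)⁻¹ - 1 := by
    simp only [odeVel, norm_smul, norm_e₁, mul_one, Real.norm_of_nonneg hnn]
    simp only [odeAmp, h1s, hsq, one_mul]
  have hrpow : (δ ^ 8) ^ (-(1 / 8 : ℝ)) = δ⁻¹ := by
    rw [← Real.rpow_natCast δ 8, ← Real.rpow_mul hδ0.le,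
      show ((8 : ℕ) : ℝ) * (-(1 / 8 : ℝ)) = -1 by norm_num, Real.rpow_neg_one]
  rw [hlhs, sub_zero, Real.one_rpow, h1s, hrpow, Real.sqrt_one] at hmain
  have hδ4 : 0 < δ ^ 4 := by positivity
  have hδ4le : δ ^ 4 ≤ 1 / 16 := by
    calc δ ^ 4 ≤ (1 / 2) ^ 4 := pow_le_pow_left₀ hδ0.le hδ2 4
      _ = 1 / 16 := by norm_num
  have hcδ : 4 * c * δ ^ 3 ≤ 1 / 8 := by
    have h1 : δ ^ 3 ≤ δ * (1 / 2) ^ 2 := by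
      have : δ ^ 3 = δ * δ ^ 2 := by ring
      rw [this]; exact mul_le_mul_of_nonneg_left (pow_le_pow_left₀ hδ0.le hδ2 2) hδ0.le
    have h2 : c * δ ≤ c * (1 / (8 * c + 1)) := mul_le_mul_of_nonneg_left hδc hc.le
    have h3 : c * (1 / (8 * c + 1)) ≤ 1 / 8 := by
      rw [mul_one_div, div_le_div_iff₀ (by positivity) (by norm_num)]
      nlinarith
    nlinarith
  have e1 : ((δ ^ 4)⁻¹ - 1) * δ ^ 4 = 1 - δ ^ 4 := by
    rw [sub_mul, inv_mul_cancel₀ hδ4.ne', one_mul]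
  have e3 : δ⁻¹ * δ ^ 4 = δ ^ 3 := by
    rw [pow_succ' δ 3, ← mul_assoc, inv_mul_cancel₀ hδne, one_mul]
  have e2 : 4 * c * 1 * 1 * δ⁻¹ * δ ^ 4 = 4 * c * δ ^ 3 := by
    calc 4 * c * 1 * 1 * δ⁻¹ * δ ^ 4 = 4 * c * (δ⁻¹ * δ ^ 4) := by ring
      _ = 4 * c * δ ^ 3 := by rw [e3]
  have key := mul_le_mul_of_nonneg_right hmain hδ4.le
  rw [e1, e2] at key
  linarith


/-! ## §7 Targets (generation 4, 2026-08-16): the vertex stub of the picked line `bp-scaled-energy`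

THE STUB (lead's skeleton eb9f89d1, `Lines/bp-scaled-energy.lean`):
`stub_scaledEnergyVertexEventually (K : ℝ) : ∃ d : ℝ≥0, ∀ M' : ℝ≥0∞, M' ≠ ⊤ → ∃ r₁, 0 < r₁ ∧ r₁ ≤ 1/4 ∧
∀ (v q G), IsSuitableWeakSolutionOn (parCylOpens 0 1) 1 0 v q → (∫⁻ z in parCyl 0 1, ‖v‖ₑ³ < ∞) →
HasWeakSpatialGradientOn (parCylOpens 0 1) v G → (∀ᵐ z ∂(vol.restrict (parCyl 0 1)), √(-z.1)‖v z.1 z.2‖ ≤ K) →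
energyA 0 (3/4) v + dissipationE 0 (3/4) G + pressureD 0 1 q ≤ M' →
∀ r ∈ Ioo 0 r₁, energyA 0 r v + dissipationE 0 r G + cubicC 0 r v + pressureD 0 r q ≤ d`
(Seregin–Šverák cylinders `𝒞(0,r) = {|x'| < r, |x₃| < r}`, `Q(0,r) = ]-r², 0[ × 𝒞(0,r)`).

READBACK / JUNK AUDIT. `energyA` = `essSup` over `t ∈ ]-r²,0[` of `r⁻¹ ∫⁻_{𝒞(0,r)} ‖v t x‖ₑ²`
(robust to null changes of the representative: a space–time null set has null `t`-sections for
a.e. `t`); `dissipationE, cubicC, pressureD` are space–time `lintegral`s (robust); the hypotheses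
are distributional identities + a.e. bounds + local integrability classes. The local energy
inequality of `IsSuitableWeakSolutionOn` is CKN (2.5) in INTEGRATED form with Bochner integrals
(junk `0` if non-integrable) — but in the suitable class (`L^∞L² ∩ L²H¹ ⇒ L^{10/3}`, `p ∈ L^{3/2}`)
every integrand is `L¹`, so no junk satisfies it vacuously. `K < 0`: hypotheses unsatisfiable
(vacuous); `K = 0`: `v = 0` a.e., `∇q = 0` in `𝒟'` so `q = q(t)` and `D(0,r;q) = 2π r ∫_{-r²}^0 |q|^{3/2} dt
≤ r·D(0,1;q) → 0` — true, and already here `r₁` must depend on `D(0,1;q)` (pressure gauge: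
`(v,q) = (0, λ)` has `D(0,r;λ) = 2π r³ λ^{3/2}`, unbounded in `λ` at fixed `r`).

WHY IT RESISTS (paper): (i) parasitic/potential local solutions `v = ∇ₓh`, `h(·,t)` harmonic in
`𝒞(0,1)`: interior harmonic estimates give `|v(x,t)| ≲ ‖v(t)‖_{L²(𝒞(0,3/4))} ≤ √((3/4) A(0,3/4))`
for `|x| ≤ 1/2` and a.e. `t`, so `A(0,r) ≲ M' r²`, `C(0,r) ≲ M'^{3/2} r³`, `E = O(r⁴)`, `D(0,r)` decays
by the harmonic pressure iteration: all `≤ d` for `r < r₁(M')` — harmless. Generalised Galilean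
junk `v(x − ξ(t), t) + ξ'(t)` adds a bounded drift (`|ξ'| ≲ √M'`): harmless. (ii) For genuine
dynamics the rate is used TWICE: the cubic flux through `∂𝒞(0,r)` over `]-4r², t*[` is
`≤ c K³ r² ∫ (-s)^{-3/2} ds ≤ 2cK³ r/ε` (`ε² = -t*/r²`), while a level `A(0,r) ≥ L` at time `t*`
forces `ε² ≤ 2πK²/L` (rate on `𝒞(0,r)`); with the local pressure `|p| ~ |v|²` this closes to
`L ≲ K² + K³/ε ≲ K² + K²√L`, i.e. `A ≲ K⁴` — the vertex bound is consistent with a POLYNOMIAL `d(K)`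
(the tree's affine Lemma 3.5 gives the constants implicitly; the global Gronwall of item 2884's
sketch gives `e^{κC}`). (iii) The tree already PROVES the affine form; the eventual form is the
contraction iterated — nothing to kill.

WHAT IS TESTABLE, AND PROVED (Negative lane, LANDED: `VertexStubParasitic.lean` p77728, `VertexStubGauge.lean`
p78013 — import `…Theorems.TypeIConcentration.Negative.VertexStubParasitic` / `.VertexStubGauge`; theorems only):
* `regParasitic_isSuitableWeakSolutionOn K δ` : `(t,x) ↦ parasiticVelocity K (t − δ²) x = (K/√(δ²−t)) e₀`
  with pressure `parasiticPressure K (t − δ²)` is suitable weak in `Q(0,1)` (tree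
  `isSuitableWeakSolutionOn_of_contDiffOn`); `regParasitic_rate` : `√(-t)‖u‖ ≤ K`;
  `regParasitic_L3`; `regParasitic_hasWeakSpatialGradientOn` (G = 0); `regParasitic_data_lt_top` :
  `A(0,3/4) + E(0,3/4) + D(0,1) < ∞` (the vertex is REGULAR: `‖u‖ ≤ K/δ` up to `t = 0`);
  `le_cubicC_regParasitic` : `C(0,r;u) ≥ 3|B_r|K³/(8r²δ)` (`3δ² ≤ r²`); `exists_lt_cubicC_regParasitic`.
* `vertexStub_false_of_dataFreeRange (hK : 0 < K)` : ¬ (the stub with `∃ r₁` BEFORE the data, i.e.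
  data hypothesis dropped) — the range of scales must depend on `M'`.
* `vertexStub_false_allScales (hK : 0 < K)` : ¬ (the stub WITH the data hypothesis but on ALL scales
  `0 < r < 1/4`) — the affine Lemma 3.5 cannot have `a(K) = 0`; the eventual reshaping is necessary.
* GAUGE companion (`VertexStubGauge.lean`, p78013): `constPressure_isSuitableWeakSolutionOn λ` (`(0, λ)` is
  suitable weak in `Q(0,1)`), `le_pressureD_const` : `D(0,r;λ) ≥ |B_r| λ^{3/2}`, `constPressure_data_lt_top`,
  `vertexStub_false_of_dataFreeRange_gauge (hK : 0 ≤ K)`, `vertexStub_false_allScales_gauge (hK : 0 ≤ K)`: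
  the pressure datum `D(0,1;q)` must enter `r₁` for GAUGE reasons (removable by mean subtraction / Tao's
  normalisation in the zoom), while the parasitic obstruction sits in `C` with a mean-free pressure and
  survives any normalisation.
NOT TESTABLE: dropping the rate, dropping `L³(Q(0,1))` (only the behaviour at the lateral boundary
near `t = 0` separates it from the suitable class; needs a ring-shaped Type-I singular local
solution), `d` independent of `K` — each needs a solution SINGULAR at the vertex (at a regular
vertex `limsup_{r→0}(A+E+C+D) = 0`), and no singular Type-I solution of Navier–Stokes is known.
CONSEQUENCE FOR THE CRUX: with the stub true and its composition landed sorry-free, `TypeIConcentration`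
is expected to close PROVED (line bp-scaled-energy); this seat's standing verdict RESISTS is final
unless Clay (A) itself falls (§2). -/


/-! ## §8 Settled (generation 5, 2026-08-16T04Z): the crux is a kernel theorem

Item stmt-NavierStokesRegularity-2881 closed `proved` (2026-08-16T04:08:38Z) by
`Summit.NavierStokesRegularity.NavierStokesRegularity.Theorems.typeIConcentration_proof`
(`Theorems/TypeICertificateLadderTypeIConcentration.lean`; axioms {propext, Classical.choice, Quot.sound},
re-verified by this seat). The theorems below are the standing adversary's sign-off: the negation of the
crux is refutable in the kernel, so no `…Refutation.lean` for this decl can ever be accepted short of an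
inconsistency in Mathlib; and the proof in hand gives a universal threshold `γ`. -/

/-- **Sign-off: the crux cannot be refuted.** `¬ TypeIConcentration` is itself refutable — the crux is
the landed theorem `Theorems.typeIConcentration_proof`. -/
theorem not_not_typeIConcentration : ¬ ¬ TypeIConcentration :=
  fun h => h Summit.NavierStokesRegularity.NavierStokesRegularity.Theorems.typeIConcentration_proof

/-- Equivalent packaging for the negatives index: a refutation of the crux is a proof of `False`. -/
theorem not_typeIConcentration_iff_false : ¬ TypeIConcentration ↔ False :=
  ⟨fun h => not_not_typeIConcentration h, False.elim⟩

/-- The support item 2884 `ScaledEnergyBound` (the crux's only open content on the Barker–Prange line,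
§2) is settled with it: `Theorems.scaledEnergyBound_proof`. -/
theorem not_not_scaledEnergyBound : ¬ ¬ ScaledEnergyBound :=
  fun h => h Summit.NavierStokesRegularity.NavierStokesRegularity.Theorems.scaledEnergyBound_proof

/-- Hence the contrapositives of §2 are now vacuous: their antecedent `¬ TypeIConcentration` is
empty (recorded so that no later seat mistakes them for live reductions). -/
theorem section2_contrapositives_vacuous (h : ¬ TypeIConcentration) :
    ¬ _root_.NavierStokesRegularity ∧ ¬ ScaledEnergyBound ∧ ¬ NoTypeIBlowup :=
  (not_not_typeIConcentration h).elim

/-- **What the landed proof actually delivers: a UNIVERSAL threshold.** The quantifier shape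
`∃ γ > 0, ∀ C > 0, ∃ ρ = ρ(C) > 0, …` — strictly stronger than the crux's `∀ C, ∃ ρ, ∃ γ` — holds:
`γ = γ_BP³` is Barker–Prange's universal constant (`bp_concentration_of_morrey`) and only the radius
`ρ(C) = ρ_BP(√(max(A(C),1)))` depends on the level, through the uniform Morrey constant `A(C)` of the
landed `scaledEnergyBound_proof`. (Certificate designers may therefore fix `γ` once and for all; `ρ`
uniform in `C` is NOT delivered and remains implausible, §(c).) -/
theorem typeIConcentration_universal_gamma :
    ∃ γ : ℝ, 0 < γ ∧ ∀ C : ℝ, 0 < C → ∃ ρ : ℝ, 0 < ρ ∧ ∀ (ν T : ℝ), 0 < ν → 0 < T →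
      ∀ (u : ℝ → E3 → E3) (p : ℝ → E3 → ℝ),
        IsClassicalNSSolutionOn (Set.Ico 0 T) ν 0 u p → IsLerayHopfOn T ν 0 (u 0) u →
        HasRapidSpatialDecay (u 0) → RateNear C ν T u → ¬ HasSmoothExtensionPast ν 0 u T →
        Concentrates ρ γ ν T u := by
  obtain ⟨γ, hγ, hBP⟩ :=
    Summit.NavierStokesRegularity.NavierStokesRegularity.Theorems.bp_concentration_of_morrey
  refine ⟨γ, hγ, fun C hC => ?_⟩
  obtain ⟨A, hA⟩ :=
    Summit.NavierStokesRegularity.NavierStokesRegularity.Theorems.scaledEnergyBound_proof C hC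
  set M : ℝ := Real.sqrt (max A 1) with hM
  have hM0 : 0 < M := Real.sqrt_pos.2 (lt_of_lt_of_le one_pos (le_max_right _ _))
  have hM2 : A ≤ M ^ 2 := by
    rw [hM, Real.sq_sqrt (le_trans zero_le_one (le_max_right _ _))]
    exact le_max_left _ _
  obtain ⟨ρ, hρ, hBPM⟩ := hBP M hM0
  refine ⟨ρ, hρ, fun ν T hν hT u p hcl hLH hdec hrate hext => ?_⟩
  obtain ⟨r₀, hr₀, hmor⟩ := hA ν T hν hT u p hcl hLH hdec hrate
  refine hBPM ν T hν hT u p hcl hLH hdec ⟨r₀, hr₀, ?_⟩ hext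
  filter_upwards [hmor] with t ht y r hr hrr
  have h1 := ht y r hr hrr
  have hr' : 0 ≤ r := hr.le
  have h3 := mul_le_mul_of_nonneg_right h1 hr'
  rw [mul_comm r⁻¹, inv_mul_cancel_right₀ hr.ne'] at h3
  calc ∫ x in Metric.ball y r, ‖u t x‖ ^ 2 ≤ A * ν ^ 2 * r := h3
    _ ≤ M ^ 2 * ν ^ 2 * r := by gcongr

/-- In particular the crux holds with the universal `γ` at every level (re-derivation of the closing
theorem through the stronger shape; definitionally the route decl). -/
theorem typeIConcentration_of_universal_gamma : TypeIConcentration := by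
  obtain ⟨γ, hγ, h⟩ := typeIConcentration_universal_gamma
  intro C hC
  obtain ⟨ρ, hρ, hlev⟩ := h C hC
  exact ⟨ρ, hρ, γ, hγ, hlev⟩

end Summit.NavierStokesRegularity.NavierStokesRegularity.Cruxes.TypeIConcentration.Disproof

end
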